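import Literature.Analysis.DeBrangesSpaces.BurnolSonineLemma2Proofs
import Literature.NumberTheory.ConnesConsani2021.ProlateProjectionsProofs
import Literature.NumberTheory.ConnesConsani2021.ProlateProjectionsCompleteness
import Literature.NumberTheory.ConnesConsani2021.ProlateEigenvalueOrdering
import HarnessLib

/-!
# Burnol 2002 (CRAS 335), Lemme 3: the vectors `e_{2n} ± 𝓕₊(e_{2n})` are eigenvectors of `P_λ + P̃_λ`
# in `G_λ`, pairwise orthogonal — proofs of the free-standing clauses, at a general cutoff `λ > 0`

LABEL (line 1): **RH-FREE** — Fourier analysis of the two cutoff projections `P_λ` (multiplication by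
`𝟙_{[−λ,λ]}`) and `P̃_λ = 𝓕⁻¹P_λ𝓕` on `L²(ℝ)` and of the prolate spheroidal functions of band `[−λ, λ]`;
`ζ` does not occur. bears_on: LADDER-RH COLUMN 6 (DBR), B-C, as corpus vocabulary only. WHAT THIS IS
NOT: not a route, not a criterion; an eigenvector computation for `P_λ + P̃_λ`; nothing here bears on
the truth of RH.

This is a PROOF-ONLY companion of `BurnolSonineStructureFunction.lean` (J.-F. Burnol, *Sur les
« espaces de Sonine » associés par de Branges à la transformation de Fourier*, C. R. Math. Acad. Sci.
Paris **335** (2002) 689–692 = arXiv:math/0208121 [Burnol2002CRAS], TeX of record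
`dbl/src/Burnol2002CRAS_arXivmath0208121.tex`), Lemme 3 (TeX l.289–293), verbatim: *Les vecteurs propres
de l'opérateur (dans `G_λ`) de Fredholm `P_λ + P̃_λ` sont les vecteurs `e_{2n} ± 𝓕₊(e_{2n})`, `n ∈ ℕ`. Ils
forment une base orthogonale de `G_λ` puisque l'opérateur est auto-adjoint* (`e_{2n}` = the even prolate
spheroidal functions of the band `[−λ,λ]`, [slepian]; "`F_λ` a les mêmes vecteurs propres que `D_λ`",
TeX l.285–287).  The named fact `Burnol2002CRAS_lem3` types it as three clauses; this file proves:

* for every `λ > 0`, UNCONDITIONALLY, **clause (i)** (`Burnol2002CRAS_lem3_i`, in the typed shape): for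
  every `n`, every tree prolate function `e = h_{2n,λ}` (`IsProlateFunction λ (2n) e`) and every `L²` class
  `E` of `e`, the vectors `E ± 𝓕E` lie in `G_λ`, are non-zero, and are eigenvectors of `P_λ + P̃_λ` —
  with the eigenvalues made explicit, `1 ± μ`, `μ = (∫_{−λ}^{λ} e)/e(0)` the eigenvalue of the finite
  Fourier transform `F_λ = P_λ𝓕P_λ` on `e` (`sumProj_add_fourier`, `sumProj_sub_fourier`), and **the
  orthogonality half of clause (iii)** (`Burnol2002CRAS_lem3_iii_orthogonal`);
* for every `λ > 0`, **clause (ii)** and **the density half of clause (iii)** FROM the two spectral inputs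
  of Slepian–Pollak at band `λ` — (h_C) completeness of the even prolate classes in `P_λ(L²)^{pair}`,
  (h_I) injectivity of `n ↦ |μ_{2n}(λ)|` — (`lem3_ii_of_complete_of_injective`,
  `lem3_iii_dense_of_complete`, door `Burnol2002CRAS_lem3_of_complete_of_injective`), where **(h_I) is
  PROVED at every band** (`injective_band`, through the virial identity `prolate_virial`, §§ J–M below),
  so that the door takes ONE input:
  **`Burnol2002CRAS_lem3_of_complete : (h_C ∀λ) → Burnol2002CRAS_lem3`**;
* **at `λ = 1` the whole of Lemme 3, UNCONDITIONALLY** (`Burnol2002CRAS_lem3_one`): there (h_C) and (h_I)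
  are the tree theorems `ConnesConsani2021.CC2021_sec4_xi_complete_holds` and
  `CC2021_sec4_lambda_basic_holds` (Connes–Consani 2021 §4, after Slepian–Pollak 1961 §III).

## The argument

Burnol's one-line proof ("`F_λ` a les mêmes vecteurs propres que `D_λ`", i.e. Slepian's commuting
miracle, and self-adjointness) is followed through the tree's GENERAL-BAND form of the commuting miracle,
`Literature.NumberTheory.LFunctions.IsProlateFunction.integral_mul_cos_eq_mul`
(`∫_{−λ}^{λ} e(x)cos(2πxω)dx = μ·e(ω)` for `|ω| ≤ λ`, file `ConnesConsani2021/ProlateProjectionsProofs.lean`,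
where the `λ = 1` instance is Connes–Consani's (cosalphan)): lifted to `L²(ℝ)` it reads
`P_λ(𝓕E) = μ·E` (`cutoffProj_fourier_eq_smul`); with `P_λE = E` (support), `𝓕𝓕E = E` and `𝓕⁻¹E = 𝓕E`
(`E` is even: the tree's `fourier_fourier_eq_compNeg`, `fourierInv_eq_fourier_compNeg`) one gets
`P̃_λE = μ·𝓕E`, `P̃_λ(𝓕E) = 𝓕E`, whence `(P_λ + P̃_λ)(E ± 𝓕E) = (1 ± μ)(E ± 𝓕E)` and
`E ± 𝓕E = P_λE + P̃_λ(±𝓕E) ∈ G_λ`.  Non-vanishing: `E ± 𝓕E = 0` would put `𝓕E` in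
`ran P_λ ∩ ran P̃_λ = 0` (the tree's `range_cutoffProj_inf_range_cutoffProjHat`: no non-zero function is
band- and time-limited), forcing `E = 0`, against `∫e² = 1`.  Orthogonality: for distinct indices
`⟪E_n, E_m⟫ = 0` is the Sturm–Liouville orthogonality of the tree prolate functions
(`IsProlateFunction.integral_mul_eq_zero_of_ne`), `⟪E_n, 𝓕E_m⟫ = ⟪E_n, P_λ𝓕E_m⟫ = μ_m⟪E_n, E_m⟫ = 0` and
`⟪𝓕E_n, 𝓕E_m⟫ = ⟪E_n, E_m⟫` (unitarity); for one index, `⟪E + 𝓕E, E − 𝓕E⟫ = ‖E‖² − ‖𝓕E‖² − μ‖E‖² + μ‖E‖² = 0`.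

Clause (ii) and density: `P_λ + P̃_λ` commutes with `𝓕` on even classes (`sumProj_fourierL2_of_mem_evenL2`),
so for an eigenvector `v ∈ G_λ` the parts `v ± 𝓕v` are eigenvectors with `𝓕w = ±w`; the time-limited
part `x = P_λw` of such a `w` satisfies `P_λ𝓕x = ±(μ−1)x` (`cutoffProj_fourierL2_cutoffProj_of_eigen`),
i.e. is an eigenvector of the finite Fourier transform, hence — by (h_C), (h_I) and
`⟪E_n, P_λ𝓕x⟫ = μ_n⟪E_n, x⟫` — a multiple of ONE prolate class (`exists_eq_smul_of_eigen`: a vector of the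
closed span of the orthonormal `E_n` with a single non-zero coefficient), and `w` is reconstructed from `x`
(`exists_eq_smul_add_of_eigen`: `w − c(E ± 𝓕E)` has zero time-limited part, is `𝓕`-(anti)symmetric and an
eigenvector, hence vanishes); both parts non-zero would force `μ_n = −μ_{n'}`, excluded by (h_I) and
`μ_n ≠ 0` (`prolate_mu_ne_zero`: the finite Fourier transform is injective, the tree's
`ae_eq_zero_of_fourier_eqOn_Ioo`).  Density: `E_n`, `𝓕E_n ∈ span{E_n ± 𝓕E_n}`, (h_C), and
`P̃_λw = 𝓕P_λ𝓕w`.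

(h_I) at every band (§§ J–M): with `G(ω) = ∫_{−λ}^{λ} e(x)cos(2πxω)dx` (`= μe(ω)` on `[−λ,λ]`, entire in
`ω`) and its derivatives `G₁, G₂` under the integral sign (`prolate_hasDerivAt_cosInt`, `_sinInt`,
`_cosInt₂`), the prolate equation integrated twice by parts gives the END-POINT RELATION
`2λG₁(λ) = (χ − (2πλ·λ)²)G(λ)` (`prolate_endpoint_relation`), whence `e(λ) ≠ 0`
(`prolate_apply_band_ne_zero`: `e(λ) = 0` would make `G`, `G₁` vanish at `λ`, and then — pairing the
differentiated commuting miracle against `e` — force `∫(2πx)²e² = 0`); pairing `G₂[e]` against a second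
prolate function `e'` (Fubini on `[−λ,λ]²` and the commuting miracle for `e'`, `prolate_integral_mul_cosInt₂`)
and Green's identity for `G[e], G[e']` on `[−λ,λ]` (`prolate_green_cosInt`: by parts, parity, the end-point
relations) yield the VIRIAL IDENTITY `λ(μ² − μ'²)∫_{−λ}^{λ}(2πx)²ee' = μμ'(χ − χ')e(λ)e'(λ)`
(`prolate_virial`); for distinct even indices `χ ≠ χ'` (`prolate_eigen_ne_of_ne`: equal eigenvalues make
the functions proportional, `IsProlateFunction.eq_mul_of_eigen_eq`, contradicting the zero counts),
`μ, μ' ≠ 0` and `e(λ)e'(λ) ≠ 0`, so `|μ| = |μ'|` is impossible (`prolate_abs_mu_injective`).  This is the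
band-`λ` form of the tree's band-1 argument `ConnesConsani2021/ProlateEigenvalueVirial.lean`
(Hogan–Lakey Thm. 2.6.1–2.6.2, Cor. 2.6.9), run on the abstract `IsProlateFunction` predicate instead of
the band-1 Frobenius objects `prolateFun`/`prolateFunAn`.

WHAT REMAINS for `Burnol2002CRAS_lem3_holds` (the named fact stays a named fact): (h_C) at a general
`λ > 0` ONLY — the completeness of the even prolate classes of band `[−λ,λ]` in `P_λ(L²(ℝ))^{pair}`
(Slepian–Pollak 1961 §III; in the tree at `λ = 1` only, `CC2021_sec4_xi_complete_holds`, through the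
band-specific development `ProlateSincOperator`, `ProlateCommutation`, `ProlateProjectionsCompleteness`
with `c = 2π`); it is the HYPOTHESIS of the door, not a new named fact.  This file adds no definition and
no new named fact (D-0026).

## References
* [Burnol2002CRAS] J.-F. Burnol, C. R. Math. Acad. Sci. Paris 335 (2002) 689–692 = arXiv:math/0208121,
  Lemme 3 (TeX l.289–293) and the paragraph before it (TeX l.279–287).
* [SlepianPollak1961] D. Slepian, H. O. Pollak, *Prolate spheroidal wave functions, Fourier analysis and
  uncertainty — I*, Bell System Tech. J. 40 (1961) 43–63, §III (the commuting miracle; tree theorem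
  `IsProlateFunction.integral_mul_cos_eq_mul`; simplicity of the spectrum of the finite Fourier transform).
* [HoganLakey2012] J. A. Hogan, J. D. Lakey, *Duration and Bandwidth Limiting*, Birkhäuser 2012,
  Thm. 2.6.1–2.6.2 and Cor. 2.6.9 (differentiating the commuting miracle; the virial-type identities).
* [Hartman2002] P. Hartman, *Ordinary Differential Equations*, SIAM Classics 38 (2002), Ch. XI §4 Thm 4.1
  (Sturm–Liouville: simple spectrum, zero counts).
-/

noncomputable section

open _root_.MeasureTheory _root_.Complex _root_.Set _root_.Filter
open scoped Real Topology FourierTransform InnerProductSpace ComplexConjugate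
open Literature.NumberTheory.LFunctions (evenL2 IsProlateFunction)
open Literature.NumberTheory.ConnesConsani2021 (cutoffProj cutoffProjHat cutoffProj_coeFn
  cutoffProjHat_apply range_cutoffProj_inf_range_cutoffProjHat isStarProjection_cutoffProj evenPart)
open Literature.Analysis.Fourier (coeFn_compNeg fourier_compNeg fourierInv_eq_fourier_compNeg
  fourier_fourier_eq_compNeg)

namespace Literature.Analysis.DeBrangesSpaces

namespace Burnol2002

/-! ## A. One prolate function `e = h_{m,λ}` and its `L²` class `E` -/

section OneProlate

variable {lam : ℝ} {m : ℕ} {e : ℝ → ℝ} {E : Lp ℂ 2 (volume : Measure ℝ)}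

/-- A tree prolate function vanishes off `[−λ, λ]`. [cite: Burnol2002CRAS, Lemme 3 (TeX l.285–287)] -/
theorem prolate_eq_zero_of_notMem_Icc (he : IsProlateFunction lam m e) {x : ℝ}
    (hx : x ∉ Icc (-lam) lam) : e x = 0 := by
  refine he.support x ?_
  rw [mem_Icc, not_and_or, not_le, not_le] at hx
  rcases hx with h | h
  · have : x < 0 := by linarith [he.lam_pos]
    rw [abs_of_neg this]; linarith
  · have : 0 < x := by linarith [he.lam_pos]
    rw [abs_of_pos this]; exact h

/-- The complexified prolate function is its own restriction to `[−λ, λ]`. [cite: Burnol2002CRAS, Lemme 3 (TeX l.285–287)] -/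
theorem prolate_ofReal_eq_indicator (he : IsProlateFunction lam m e) :
    (fun x ↦ (e x : ℂ)) = (Icc (-lam) lam).indicator (fun x ↦ (e x : ℂ)) := by
  funext x
  by_cases hx : x ∈ Icc (-lam) lam
  · rw [indicator_of_mem hx]
  · rw [indicator_of_notMem hx, (prolate_eq_zero_of_notMem_Icc he) hx, Complex.ofReal_zero]

/-- The complexified prolate function is continuous on `[−λ, λ]`. [cite: Burnol2002CRAS, Lemme 3 (TeX l.285–287)] -/
theorem prolate_continuousOn_ofReal (he : IsProlateFunction lam m e) :
    ContinuousOn (fun x ↦ (e x : ℂ)) (Icc (-lam) lam) :=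
  Complex.continuous_ofReal.comp_continuousOn he.contDiffOn.continuousOn

/-- The complexified prolate function is integrable. [cite: Burnol2002CRAS, Lemme 3 (TeX l.285–287)] -/
theorem prolate_integrable_ofReal (he : IsProlateFunction lam m e) :
    Integrable (fun x ↦ (e x : ℂ)) (volume : Measure ℝ) := by
  rw [(prolate_ofReal_eq_indicator he), integrable_indicator_iff measurableSet_Icc]
  exact (prolate_continuousOn_ofReal he).integrableOn_compact isCompact_Icc

/-- The complexified prolate function is square integrable. [cite: Burnol2002CRAS, Lemme 3 (TeX l.285–287)] -/
theorem prolate_memLp_ofReal (he : IsProlateFunction lam m e) :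
    MemLp (fun x ↦ (e x : ℂ)) 2 (volume : Measure ℝ) := by
  rw [(prolate_ofReal_eq_indicator he), memLp_indicator_iff_restrict measurableSet_Icc]
  haveI : IsFiniteMeasure ((volume : Measure ℝ).restrict (Icc (-lam) lam)) := by
    refine ⟨?_⟩
    rw [Measure.restrict_apply_univ]
    exact measure_Icc_lt_top
  obtain ⟨C, hC⟩ := isCompact_Icc.exists_bound_of_continuousOn (prolate_continuousOn_ofReal he)
  exact MemLp.of_bound ((prolate_continuousOn_ofReal he).aestronglyMeasurable measurableSet_Icc) C
    ((ae_restrict_iff' measurableSet_Icc).mpr (Eventually.of_forall hC))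

/-- An `L²` class of `e` IS the class `toLp e`. [cite: Burnol2002CRAS, Lemme 3 (TeX l.285–287)] -/
theorem eq_toLp_of_ae_eq (he : IsProlateFunction lam m e) (hE : ∀ᵐ x : ℝ, E x = (e x : ℂ)) :
    E = ((prolate_memLp_ofReal he)).toLp _ := by
  refine Lp.ext ?_
  filter_upwards [hE, (prolate_memLp_ofReal he).coeFn_toLp] with x h1 h2
  rw [h1, h2]

/-- `∫_ℝ e·k = ∫_{−λ}^{λ} e·k` (support of `e`). [cite: Burnol2002CRAS, Lemme 3 (TeX l.285–287)] -/
theorem prolate_integral_ofReal_mul (he : IsProlateFunction lam m e) (k : ℝ → ℂ) :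
    ∫ v, (e v : ℂ) * k v = ∫ v in (-lam)..lam, (e v : ℂ) * k v := by
  have h : (fun v ↦ (e v : ℂ) * k v) = (Icc (-lam) lam).indicator (fun v ↦ (e v : ℂ) * k v) := by
    funext v
    by_cases hv : v ∈ Icc (-lam) lam
    · rw [indicator_of_mem hv]
    · rw [indicator_of_notMem hv, (prolate_eq_zero_of_notMem_Icc he) hv]; simp
  conv_lhs => rw [h]
  rw [integral_indicator measurableSet_Icc, integral_Icc_eq_integral_Ioc,
    ← intervalIntegral.integral_of_le (by linarith [he.lam_pos] : -lam ≤ lam)]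

/-- **The commuting miracle in complex-exponential form, general band**:
`∫_{−λ}^{λ} e(x) e^{2πixω} dx = μ·e(ω)` for `|ω| ≤ λ`, `μ = (∫_{−λ}^{λ} e)/e(0)` (the sine part vanishes,
`e` being even). [cite: Burnol2002CRAS, Lemme 3 (TeX l.285–287); SlepianPollak1961, §III] -/
theorem prolate_intervalIntegral_ofReal_mul_cexp (he : IsProlateFunction lam m e) {ω : ℝ}
    (hω : ω ∈ Icc (-lam) lam) :
    ∫ x in (-lam)..lam, (e x : ℂ) * cexp (2 * π * I * x * ω) =
      ((((∫ x in (-lam)..lam, e x) / e 0 : ℝ)) : ℂ) * e ω := by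
  have hlam := he.lam_pos
  have hfc : ContinuousOn e (Icc (-lam) lam) := he.contDiffOn.continuousOn
  have hcos := he.integral_mul_cos_eq_mul hω
  have hsin : ∫ x in (-lam)..lam, e x * Real.sin (2 * π * x * ω) = 0 := by
    have h : (∫ x in (-lam)..lam, e (-x) * Real.sin (2 * π * (-x) * ω))
        = ∫ x in (-lam)..lam, e x * Real.sin (2 * π * x * ω) := by
      simpa only [neg_neg] using intervalIntegral.integral_comp_neg (a := -lam) (b := lam)
        (fun x ↦ e x * Real.sin (2 * π * x * ω))
    have h2 : (∫ x in (-lam)..lam, e (-x) * Real.sin (2 * π * (-x) * ω))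
        = -∫ x in (-lam)..lam, e x * Real.sin (2 * π * x * ω) := by
      rw [← intervalIntegral.integral_neg]
      refine intervalIntegral.integral_congr fun x _ ↦ ?_
      simp only [he.even x]
      rw [show 2 * π * (-x) * ω = -(2 * π * x * ω) by ring, Real.sin_neg]
      ring
    linarith
  have hc1 : ContinuousOn (fun x : ℝ ↦ ((e x * Real.cos (2 * π * x * ω) : ℝ) : ℂ)) (Icc (-lam) lam) :=
    Complex.continuous_ofReal.comp_continuousOn (hfc.mul (by fun_prop))
  have hc2 : ContinuousOn (fun x : ℝ ↦ ((e x * Real.sin (2 * π * x * ω) : ℝ) : ℂ) * I) (Icc (-lam) lam) :=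
    (Complex.continuous_ofReal.comp_continuousOn (hfc.mul (by fun_prop))).mul continuousOn_const
  have hint : ∫ x in (-lam)..lam, (e x : ℂ) * cexp (2 * π * I * x * ω)
      = ((∫ x in (-lam)..lam, e x * Real.cos (2 * π * x * ω) : ℝ) : ℂ)
        + ((∫ x in (-lam)..lam, e x * Real.sin (2 * π * x * ω) : ℝ) : ℂ) * I := by
    have eq : (fun x : ℝ ↦ (e x : ℂ) * cexp (2 * π * I * x * ω))
        = fun x : ℝ ↦ ((e x * Real.cos (2 * π * x * ω) : ℝ) : ℂ)
          + ((e x * Real.sin (2 * π * x * ω) : ℝ) : ℂ) * I := by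
      funext x
      have : (2 * π * I * x * ω : ℂ) = ((2 * π * x * ω : ℝ) : ℂ) * I := by push_cast; ring
      rw [this, Complex.exp_mul_I, ← Complex.ofReal_cos, ← Complex.ofReal_sin]
      push_cast; ring
    rw [eq, intervalIntegral.integral_add (hc1.intervalIntegrable_of_Icc (by linarith))
        (hc2.intervalIntegrable_of_Icc (by linarith)), intervalIntegral.integral_mul_const,
      intervalIntegral.integral_ofReal, intervalIntegral.integral_ofReal]
  rw [hint, hsin, hcos]
  push_cast; ring

/-- **`𝓕e = μ·e` on `[−λ, λ]`** (pointwise, for the Fourier INTEGRAL of the complexified prolate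
function). [cite: Burnol2002CRAS, Lemme 3 (TeX l.285–287); SlepianPollak1961, §III] -/
theorem prolate_fourierIntegral_ofReal_eq (he : IsProlateFunction lam m e) {ω : ℝ}
    (hω : ω ∈ Icc (-lam) lam) :
    𝓕 (fun x ↦ (e x : ℂ)) ω = ((((∫ x in (-lam)..lam, e x) / e 0 : ℝ)) : ℂ) * e ω := by
  have hω' : -ω ∈ Icc (-lam) lam := ⟨by linarith [hω.2], by linarith [hω.1]⟩
  have key := (prolate_intervalIntegral_ofReal_mul_cexp he) hω'
  rw [he.even] at key
  rw [Real.fourier_real_eq_integral_exp_smul]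
  have eq : (fun v : ℝ ↦ cexp (↑(-2 * π * v * ω) * I) • (e v : ℂ))
      = fun v : ℝ ↦ (e v : ℂ) * cexp (2 * π * I * v * ↑(-ω)) := by
    funext v
    rw [smul_eq_mul, mul_comm]
    congr 2
    push_cast; ring
  rw [eq, (prolate_integral_ofReal_mul he), key]

/-- **`P_λ E = E`** (`e` is supported in `[−λ, λ]`). [cite: Burnol2002CRAS, Lemme 3 (TeX l.279–287)] -/
theorem cutoffProj_eq_self (he : IsProlateFunction lam m e) (hE : ∀ᵐ x : ℝ, E x = (e x : ℂ)) :
    cutoffProj lam E = E := by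
  apply Lp.ext
  filter_upwards [cutoffProj_coeFn lam E, hE] with x h1 h2
  rw [h1]
  by_cases hx : x ∈ Icc (-lam) lam
  · rw [indicator_of_mem hx]
  · rw [indicator_of_notMem hx, h2, (prolate_eq_zero_of_notMem_Icc he) hx, Complex.ofReal_zero]

/-- The `L²` Fourier transform of `E` is a.e. the Fourier integral of `e`. [cite: Burnol2002CRAS, Lemme 3 (TeX l.285–287)] -/
theorem fourier_coeFn_ae_eq (he : IsProlateFunction lam m e) (hE : ∀ᵐ x : ℝ, E x = (e x : ℂ)) :
    ((𝓕 E : Lp ℂ 2 (volume : Measure ℝ)) : ℝ → ℂ) =ᵐ[volume] 𝓕 (fun x ↦ (e x : ℂ)) := by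
  rw [eq_toLp_of_ae_eq he hE]
  exact Literature.Analysis.FluidPDE.FourierNS.fourier_toLp_ae_eq (prolate_integrable_ofReal he) (prolate_memLp_ofReal he)

/-- **`P_λ(𝓕E) = μ·E`**: the commuting miracle in `L²(ℝ)` (the general-band form of Connes–Consani's
`𝒫₁η_n = λ(n)ξ_n`). [cite: Burnol2002CRAS, Lemme 3 (TeX l.285–287); SlepianPollak1961, §III] -/
theorem cutoffProj_fourier_eq_smul (he : IsProlateFunction lam m e) (hE : ∀ᵐ x : ℝ, E x = (e x : ℂ)) :
    cutoffProj lam (𝓕 E : Lp ℂ 2 (volume : Measure ℝ)) =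
      ((((∫ x in (-lam)..lam, e x) / e 0 : ℝ)) : ℂ) • E := by
  apply Lp.ext
  filter_upwards [cutoffProj_coeFn lam (𝓕 E : Lp ℂ 2 (volume : Measure ℝ)), fourier_coeFn_ae_eq he hE,
    Lp.coeFn_smul ((((∫ x in (-lam)..lam, e x) / e 0 : ℝ)) : ℂ) E, hE] with x h1 h2 h3 h4
  rw [h1, h3, Pi.smul_apply, h4, smul_eq_mul]
  by_cases hx : x ∈ Icc (-lam) lam
  · rw [indicator_of_mem hx, h2, (prolate_fourierIntegral_ofReal_eq he) hx]
  · rw [indicator_of_notMem hx, (prolate_eq_zero_of_notMem_Icc he) hx, Complex.ofReal_zero, mul_zero]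

/-- `E` is even (a.e.). [cite: Burnol2002CRAS, Lemme 3 (TeX l.285–287)] -/
theorem mem_evenL2 (he : IsProlateFunction lam m e) (hE : ∀ᵐ x : ℝ, E x = (e x : ℂ)) :
    E ∈ evenL2 := by
  have hq : Measure.QuasiMeasurePreserving (fun x : ℝ ↦ -x) volume volume :=
    (Measure.measurePreserving_neg (volume : Measure ℝ)).quasiMeasurePreserving
  have h2 : ∀ᵐ x : ℝ, (E : ℝ → ℂ) (-x) = (e (-x) : ℂ) := hq.ae_eq hE
  show ∀ᵐ x : ℝ, (E : ℝ → ℂ) (-x) = (E : ℝ → ℂ) x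
  filter_upwards [hE, h2] with x h1 h3
  rw [h3, h1, he.even]

/-- `E` is fixed by the reflection `x ↦ −x`. [cite: Burnol2002CRAS, Lemme 3 (TeX l.285–287)] -/
theorem compNeg_eq_self (he : IsProlateFunction lam m e) (hE : ∀ᵐ x : ℝ, E x = (e x : ℂ)) :
    Lp.compMeasurePreserving (fun x : ℝ ↦ -x) (Measure.measurePreserving_neg (volume : Measure ℝ)) E
      = E := by
  refine Lp.ext ?_
  filter_upwards [coeFn_compNeg (F := ℂ) E, mem_evenL2 he hE] with x hx h2
  rw [hx, h2]

/-- **`𝓕𝓕E = E`** (`𝓕² =` reflection, `E` even). [cite: Burnol2002CRAS, §2 (TeX l.207–210)] -/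
theorem fourier_fourier_eq_self (he : IsProlateFunction lam m e) (hE : ∀ᵐ x : ℝ, E x = (e x : ℂ)) :
    (𝓕 (𝓕 E : Lp ℂ 2 (volume : Measure ℝ)) : Lp ℂ 2 (volume : Measure ℝ)) = E := by
  rw [fourier_fourier_eq_compNeg, compNeg_eq_self he hE]

/-- **`𝓕⁻¹E = 𝓕E`** (`E` even). [cite: Burnol2002CRAS, §2 (TeX l.207–210)] -/
theorem fourierInv_eq_fourier (he : IsProlateFunction lam m e) (hE : ∀ᵐ x : ℝ, E x = (e x : ℂ)) :
    (𝓕⁻ E : Lp ℂ 2 (volume : Measure ℝ)) = (𝓕 E : Lp ℂ 2 (volume : Measure ℝ)) := by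
  rw [fourierInv_eq_fourier_compNeg, compNeg_eq_self he hE]

/-- **`P̃_λ E = μ·𝓕E`**. [cite: Burnol2002CRAS, Lemme 3 (TeX l.285–293)] -/
theorem cutoffProjHat_eq_smul_fourier (he : IsProlateFunction lam m e) (hE : ∀ᵐ x : ℝ, E x = (e x : ℂ)) :
    cutoffProjHat lam E =
      ((((∫ x in (-lam)..lam, e x) / e 0 : ℝ)) : ℂ) • (𝓕 E : Lp ℂ 2 (volume : Measure ℝ)) := by
  rw [cutoffProjHat_apply, cutoffProj_fourier_eq_smul he hE, FourierTransform.fourierInv_smul,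
    fourierInv_eq_fourier he hE]

/-- **`P̃_λ(𝓕E) = 𝓕E`**. [cite: Burnol2002CRAS, Lemme 3 (TeX l.285–293)] -/
theorem cutoffProjHat_fourier_eq (he : IsProlateFunction lam m e) (hE : ∀ᵐ x : ℝ, E x = (e x : ℂ)) :
    cutoffProjHat lam (𝓕 E : Lp ℂ 2 (volume : Measure ℝ)) = (𝓕 E : Lp ℂ 2 (volume : Measure ℝ)) := by
  rw [cutoffProjHat_apply, fourier_fourier_eq_self he hE, cutoffProj_eq_self he hE,
    fourierInv_eq_fourier he hE]

/-- **`(P_λ + P̃_λ)(E + 𝓕E) = (1 + μ)(E + 𝓕E)`** — the `+` vector of Lemme 3 is an eigenvector, with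
its eigenvalue. [cite: Burnol2002CRAS, Lemme 3 (TeX l.289–293)] -/
theorem sumProj_add_fourier (he : IsProlateFunction lam m e) (hE : ∀ᵐ x : ℝ, E x = (e x : ℂ)) :
    sumProj lam (E + fourierL2 E) =
      ((1 : ℂ) + ((((∫ x in (-lam)..lam, e x) / e 0 : ℝ)) : ℂ)) • (E + fourierL2 E) := by
  rw [sumProj_apply, map_add, map_add, fourierL2_apply, cutoffProj_eq_self he hE,
    cutoffProj_fourier_eq_smul he hE, cutoffProjHat_eq_smul_fourier he hE, cutoffProjHat_fourier_eq he hE]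
  module

/-- **`(P_λ + P̃_λ)(E − 𝓕E) = (1 − μ)(E − 𝓕E)`** — the `−` vector of Lemme 3 is an eigenvector, with
its eigenvalue. [cite: Burnol2002CRAS, Lemme 3 (TeX l.289–293)] -/
theorem sumProj_sub_fourier (he : IsProlateFunction lam m e) (hE : ∀ᵐ x : ℝ, E x = (e x : ℂ)) :
    sumProj lam (E - fourierL2 E) =
      ((1 : ℂ) - ((((∫ x in (-lam)..lam, e x) / e 0 : ℝ)) : ℂ)) • (E - fourierL2 E) := by
  rw [sumProj_apply, map_sub, map_sub, fourierL2_apply, cutoffProj_eq_self he hE,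
    cutoffProj_fourier_eq_smul he hE, cutoffProjHat_eq_smul_fourier he hE, cutoffProjHat_fourier_eq he hE]
  module

/-- `𝓕E` is even. [cite: Burnol2002CRAS, §2 (TeX l.207–210)] -/
theorem fourier_mem_evenL2 (he : IsProlateFunction lam m e) (hE : ∀ᵐ x : ℝ, E x = (e x : ℂ)) :
    (fourierL2 E) ∈ evenL2 := by
  have h : Lp.compMeasurePreserving (fun x : ℝ ↦ -x) (Measure.measurePreserving_neg (volume : Measure ℝ))
      (fourierL2 E) = fourierL2 E := by
    rw [fourierL2_apply, ← fourier_compNeg, compNeg_eq_self he hE]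
  have h2 := coeFn_compNeg (F := ℂ) (fourierL2 E)
  rw [h] at h2
  show ∀ᵐ x : ℝ, (fourierL2 E : ℝ → ℂ) (-x) = (fourierL2 E : ℝ → ℂ) x
  filter_upwards [h2] with x hx
  exact hx.symm

/-- **`E + 𝓕E ∈ G_λ`** (`= P_λE + P̃_λ(𝓕E)` with `E`, `𝓕E` even). [cite: Burnol2002CRAS, Lemme 3 (TeX l.289–293)] -/
theorem add_fourier_mem_Gspace (he : IsProlateFunction lam m e) (hE : ∀ᵐ x : ℝ, E x = (e x : ℂ)) :
    E + fourierL2 E ∈ Gspace lam := by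
  refine ⟨E, fourierL2 E, mem_evenL2 he hE, fourier_mem_evenL2 he hE, ?_⟩
  rw [cutoffProj_eq_self he hE, fourierL2_apply, cutoffProjHat_fourier_eq he hE]

/-- **`E − 𝓕E ∈ G_λ`** (`= P_λE + P̃_λ(−𝓕E)`). [cite: Burnol2002CRAS, Lemme 3 (TeX l.289–293)] -/
theorem sub_fourier_mem_Gspace (he : IsProlateFunction lam m e) (hE : ∀ᵐ x : ℝ, E x = (e x : ℂ)) :
    E - fourierL2 E ∈ Gspace lam := by
  refine ⟨E, -fourierL2 E, mem_evenL2 he hE, evenPart.neg_mem (fourier_mem_evenL2 he hE), ?_⟩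
  rw [cutoffProj_eq_self he hE, map_neg, fourierL2_apply, cutoffProjHat_fourier_eq he hE, sub_eq_add_neg]

/-- `E ≠ 0` (`∫_{−λ}^{λ} e² = 1`). [cite: Burnol2002CRAS, Lemme 3 (TeX l.285–287)] -/
theorem ne_zero (he : IsProlateFunction lam m e) (hE : ∀ᵐ x : ℝ, E x = (e x : ℂ)) : E ≠ 0 := by
  intro h0
  have h1 : ∀ᵐ x : ℝ, (e x : ℂ) = 0 := by
    have hz := Lp.coeFn_zero ℂ 2 (volume : Measure ℝ)
    rw [← h0] at hz
    filter_upwards [hE, hz] with x h2 h3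
    rw [← h2, h3, Pi.zero_apply]
  have h2 : ∀ᵐ x : ℝ, e x ^ 2 = (0 : ℝ) := by
    filter_upwards [h1] with x hx
    rw [Complex.ofReal_eq_zero] at hx
    rw [hx]; ring
  have h3 : ∫ x in (-lam)..lam, e x ^ 2 = ∫ x in (-lam)..lam, (0 : ℝ) :=
    intervalIntegral.integral_congr_ae (h2.mono fun x hx _ ↦ hx)
  rw [he.norm_one, intervalIntegral.integral_zero] at h3
  exact one_ne_zero h3

/-- `𝓕E` vanishes only if `E` does. [cite: Burnol2002CRAS, §2 (TeX l.207–210)] -/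
theorem fourierL2_ne_zero (he : IsProlateFunction lam m e) (hE : ∀ᵐ x : ℝ, E x = (e x : ℂ)) :
    fourierL2 E ≠ 0 := by
  intro h
  apply ne_zero he hE
  have h2 : (𝓕⁻ (𝓕 E : Lp ℂ 2 (volume : Measure ℝ)) : Lp ℂ 2 (volume : Measure ℝ)) = E :=
    FourierTransform.fourierInv_fourier_eq E
  rw [← fourierL2_apply, h] at h2
  rw [← h2]
  exact (FourierTransform.fourierInvₗ ℂ (Lp ℂ 2 (volume : Measure ℝ))).map_zero

/-- A vector of `ran P_λ ∩ ran P̃_λ` is zero (no non-zero function is time- and band-limited).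
[cite: Burnol2002CRAS, Lemme 2, proof (TeX l.279–281)] -/
theorem eq_zero_of_cutoffProj_eq_of_cutoffProjHat_eq {lam : ℝ} {v : Lp ℂ 2 (volume : Measure ℝ)}
    (h1 : cutoffProj lam v = v) (h2 : cutoffProjHat lam v = v) : v = 0 := by
  have hmem : v ∈ (cutoffProj lam).range ⊓ (cutoffProjHat lam).range :=
    ⟨⟨v, h1⟩, ⟨v, h2⟩⟩
  rw [range_cutoffProj_inf_range_cutoffProjHat lam lam] at hmem
  exact (Submodule.mem_bot ℂ).mp hmem

/-- **`E + 𝓕E ≠ 0`** (else `𝓕E = −E` would be time- and band-limited). [cite: Burnol2002CRAS, Lemme 3 (TeX l.289–293)] -/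
theorem add_fourier_ne_zero (he : IsProlateFunction lam m e) (hE : ∀ᵐ x : ℝ, E x = (e x : ℂ)) :
    E + fourierL2 E ≠ 0 := by
  intro h
  have hF : fourierL2 E = -E := eq_neg_of_add_eq_zero_right h
  apply fourierL2_ne_zero he hE
  refine eq_zero_of_cutoffProj_eq_of_cutoffProjHat_eq (lam := lam) ?_ ?_
  · rw [hF, map_neg, cutoffProj_eq_self he hE]
  · rw [fourierL2_apply, cutoffProjHat_fourier_eq he hE]

/-- **`E − 𝓕E ≠ 0`** (else `𝓕E = E` would be time- and band-limited). [cite: Burnol2002CRAS, Lemme 3 (TeX l.289–293)] -/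
theorem sub_fourier_ne_zero (he : IsProlateFunction lam m e) (hE : ∀ᵐ x : ℝ, E x = (e x : ℂ)) :
    E - fourierL2 E ≠ 0 := by
  intro h
  have hF : fourierL2 E = E := (sub_eq_zero.mp h).symm
  apply fourierL2_ne_zero he hE
  refine eq_zero_of_cutoffProj_eq_of_cutoffProjHat_eq (lam := lam) ?_ ?_
  · rw [hF, cutoffProj_eq_self he hE]
  · rw [fourierL2_apply, cutoffProjHat_fourier_eq he hE]

end OneProlate

/-! ## B. Lemme 3, clause (i), in the typed shape -/

/-- **Burnol 2002, Lemme 3, clause (i)** — verbatim the first conjunct of the named fact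
`Burnol2002CRAS_lem3`, for every `λ > 0`: for the even prolate spheroidal function `e = e_{2n}` of band
`[−λ, λ]` and any `L²` class `E` of it, `E ± 𝓕E ∈ G_λ`, `E ± 𝓕E ≠ 0`, and `E ± 𝓕E` is an eigenvector of
`P_λ + P̃_λ` (eigenvalues `1 ± μ_{2n}(λ)`, `sumProj_add_fourier` / `sumProj_sub_fourier`).
[cite: Burnol2002CRAS, Lemme 3 (TeX l.289–293)] -/
theorem Burnol2002CRAS_lem3_i (lam : ℝ) (_hlam : 0 < lam) (n : ℕ) (e : ℝ → ℝ)
    (E : Lp ℂ 2 (volume : Measure ℝ)) (he : IsProlateFunction lam (2 * n) e)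
    (hE : ∀ᵐ x : ℝ, E x = (e x : ℂ)) :
    (E + fourierL2 E ∈ Gspace lam ∧ E + fourierL2 E ≠ 0 ∧
        ∃ μ : ℂ, sumProj lam (E + fourierL2 E) = μ • (E + fourierL2 E)) ∧
      (E - fourierL2 E ∈ Gspace lam ∧ E - fourierL2 E ≠ 0 ∧
        ∃ μ : ℂ, sumProj lam (E - fourierL2 E) = μ • (E - fourierL2 E)) :=
  ⟨⟨add_fourier_mem_Gspace he hE, add_fourier_ne_zero he hE, ⟨_, sumProj_add_fourier he hE⟩⟩,
    ⟨sub_fourier_mem_Gspace he hE, sub_fourier_ne_zero he hE, ⟨_, sumProj_sub_fourier he hE⟩⟩⟩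

/-! ## C. Lemme 3, clause (iii), orthogonality half: the vectors `E_n ± 𝓕E_n` are pairwise orthogonal -/

section Orthogonal

variable {lam : ℝ} {m m' : ℕ} {e e' : ℝ → ℝ} {E E' : Lp ℂ 2 (volume : Measure ℝ)}

/-- `⟪E, E'⟫ = ∫_{−λ}^{λ} e·e'` for the classes of two (real) prolate functions of the same band.
[cite: Burnol2002CRAS, Lemme 3 (TeX l.289–293)] -/
theorem inner_eq_intervalIntegral (he : IsProlateFunction lam m e)
    (hE : ∀ᵐ x : ℝ, E x = (e x : ℂ)) (hE' : ∀ᵐ x : ℝ, E' x = (e' x : ℂ)) :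
    ⟪E, E'⟫_ℂ = ((∫ x in (-lam)..lam, e x * e' x : ℝ) : ℂ) := by
  rw [L2.inner_def]
  have h1 : ∫ x : ℝ, ⟪(E : ℝ → ℂ) x, (E' : ℝ → ℂ) x⟫_ℂ = ∫ x : ℝ, (e x : ℂ) * (e' x : ℂ) := by
    refine integral_congr_ae ?_
    filter_upwards [hE, hE'] with x h2 h3
    rw [h2, h3, RCLike.inner_apply, conj_ofReal, mul_comm]
  rw [h1, prolate_integral_ofReal_mul he (fun v ↦ (e' v : ℂ))]
  have h2 : (fun v : ℝ ↦ (e v : ℂ) * (e' v : ℂ)) = fun v : ℝ ↦ ((e v * e' v : ℝ) : ℂ) := by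
    funext v; push_cast; ring
  rw [h2, intervalIntegral.integral_ofReal]

/-- **Sturm–Liouville orthogonality in `L²(ℝ)`**: `⟪E, E'⟫ = 0` for prolate functions of distinct
indices. [cite: Burnol2002CRAS, Lemme 3 (TeX l.289–293)] -/
theorem inner_eq_zero_of_ne (he : IsProlateFunction lam m e) (he' : IsProlateFunction lam m' e')
    (hE : ∀ᵐ x : ℝ, E x = (e x : ℂ)) (hE' : ∀ᵐ x : ℝ, E' x = (e' x : ℂ)) (hmm' : m ≠ m') :
    ⟪E, E'⟫_ℂ = 0 := by
  rw [inner_eq_intervalIntegral he hE hE', he.integral_mul_eq_zero_of_ne he' hmm', Complex.ofReal_zero]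

/-- `⟪E, 𝓕E'⟫ = μ'·⟪E, E'⟫` (`⟪E, 𝓕E'⟫ = ⟪P_λE, 𝓕E'⟫ = ⟪E, P_λ𝓕E'⟫`). [cite: Burnol2002CRAS, Lemme 3 (TeX l.289–293)] -/
theorem inner_fourierL2_right (he : IsProlateFunction lam m e) (he' : IsProlateFunction lam m' e')
    (hE : ∀ᵐ x : ℝ, E x = (e x : ℂ)) (hE' : ∀ᵐ x : ℝ, E' x = (e' x : ℂ)) :
    ⟪E, fourierL2 E'⟫_ℂ = ((((∫ x in (-lam)..lam, e' x) / e' 0 : ℝ)) : ℂ) * ⟪E, E'⟫_ℂ := by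
  have hP := isStarProjection_cutoffProj lam
  calc ⟪E, fourierL2 E'⟫_ℂ = ⟪cutoffProj lam E, fourierL2 E'⟫_ℂ := by rw [cutoffProj_eq_self he hE]
    _ = ⟪E, ContinuousLinearMap.adjoint (cutoffProj lam) (fourierL2 E')⟫_ℂ :=
        (ContinuousLinearMap.adjoint_inner_right _ _ _).symm
    _ = ⟪E, cutoffProj lam (fourierL2 E')⟫_ℂ := by rw [hP.isSelfAdjoint.adjoint_eq]
    _ = ((((∫ x in (-lam)..lam, e' x) / e' 0 : ℝ)) : ℂ) * ⟪E, E'⟫_ℂ := by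
        rw [fourierL2_apply, cutoffProj_fourier_eq_smul he' hE', inner_smul_right]

/-- `⟪𝓕E, E'⟫ = μ·⟪E, E'⟫` (`μ` is real). [cite: Burnol2002CRAS, Lemme 3 (TeX l.289–293)] -/
theorem inner_fourierL2_left (he : IsProlateFunction lam m e) (he' : IsProlateFunction lam m' e')
    (hE : ∀ᵐ x : ℝ, E x = (e x : ℂ)) (hE' : ∀ᵐ x : ℝ, E' x = (e' x : ℂ)) :
    ⟪fourierL2 E, E'⟫_ℂ = ((((∫ x in (-lam)..lam, e x) / e 0 : ℝ)) : ℂ) * ⟪E, E'⟫_ℂ := by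
  rw [← inner_conj_symm, inner_fourierL2_right he' he hE' hE, map_mul, Complex.conj_ofReal,
    inner_conj_symm]

/-- `⟪𝓕E, 𝓕E'⟫ = ⟪E, E'⟫` (the `L²` Fourier transform is unitary). [cite: Burnol2002CRAS, §2 (TeX l.207–210)] -/
theorem inner_fourierL2_fourierL2 (E E' : Lp ℂ 2 (volume : Measure ℝ)) :
    ⟪fourierL2 E, fourierL2 E'⟫_ℂ = ⟪E, E'⟫_ℂ :=
  (Lp.fourierTransformₗᵢ ℝ ℂ).inner_map_map E E'

/-- **Distinct indices**: each of `E ± 𝓕E` is orthogonal to each of `E' ± 𝓕E'` when the prolate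
indices differ. [cite: Burnol2002CRAS, Lemme 3 (TeX l.289–293)] -/
theorem inner_eq_zero_of_index_ne (he : IsProlateFunction lam m e) (he' : IsProlateFunction lam m' e')
    (hE : ∀ᵐ x : ℝ, E x = (e x : ℂ)) (hE' : ∀ᵐ x : ℝ, E' x = (e' x : ℂ)) (hmm' : m ≠ m')
    {v v' : Lp ℂ 2 (volume : Measure ℝ)} (hv : v = E + fourierL2 E ∨ v = E - fourierL2 E)
    (hv' : v' = E' + fourierL2 E' ∨ v' = E' - fourierL2 E') : ⟪v, v'⟫_ℂ = 0 := by
  have h0 := inner_eq_zero_of_ne he he' hE hE' hmm'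
  have h1 : ⟪E, fourierL2 E'⟫_ℂ = 0 := by rw [inner_fourierL2_right he he' hE hE', h0, mul_zero]
  have h2 : ⟪fourierL2 E, E'⟫_ℂ = 0 := by rw [inner_fourierL2_left he he' hE hE', h0, mul_zero]
  have h3 : ⟪fourierL2 E, fourierL2 E'⟫_ℂ = 0 := by rw [inner_fourierL2_fourierL2, h0]
  rcases hv with rfl | rfl <;> rcases hv' with rfl | rfl <;>
    simp only [inner_add_left, inner_add_right, inner_sub_left, inner_sub_right, h0, h1, h2, h3,
      add_zero, sub_self]

/-- **One index**: `⟪E + 𝓕E, E − 𝓕E⟫ = 0` (`‖𝓕E‖ = ‖E‖` and `⟪E, 𝓕E⟫ = ⟪𝓕E, E⟫ = μ‖E‖²`).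
[cite: Burnol2002CRAS, Lemme 3 (TeX l.289–293)] -/
theorem inner_add_fourierL2_sub_fourierL2 (he : IsProlateFunction lam m e)
    (hE : ∀ᵐ x : ℝ, E x = (e x : ℂ)) : ⟪E + fourierL2 E, E - fourierL2 E⟫_ℂ = 0 := by
  rw [inner_add_left, inner_sub_right, inner_sub_right, inner_fourierL2_right he he hE hE,
    inner_fourierL2_left he he hE hE, inner_fourierL2_fourierL2]
  ring

/-- **One index**: `⟪E − 𝓕E, E + 𝓕E⟫ = 0`. [cite: Burnol2002CRAS, Lemme 3 (TeX l.289–293)] -/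
theorem inner_sub_fourierL2_add_fourierL2 (he : IsProlateFunction lam m e)
    (hE : ∀ᵐ x : ℝ, E x = (e x : ℂ)) : ⟪E - fourierL2 E, E + fourierL2 E⟫_ℂ = 0 := by
  rw [← inner_conj_symm, inner_add_fourierL2_sub_fourierL2 he hE, map_zero]

/-- Two `L²` classes of the same function coincide. [folklore] -/
private theorem eq_of_ae_eq_ofReal {E E' : Lp ℂ 2 (volume : Measure ℝ)} {e : ℝ → ℝ}
    (hE : ∀ᵐ x : ℝ, E x = (e x : ℂ)) (hE' : ∀ᵐ x : ℝ, E' x = (e x : ℂ)) : E = E' := by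
  refine Lp.ext ?_
  filter_upwards [hE, hE'] with x h1 h2
  rw [h1, h2]

end Orthogonal

/-- **Burnol 2002, Lemme 3, clause (iii), ORTHOGONALITY half** — verbatim the first conjunct of the third
clause of the named fact `Burnol2002CRAS_lem3`, for every `λ > 0`: the set of all vectors
`E_{2n} ± 𝓕E_{2n}` (`E_{2n}` an `L²` class of the even prolate function `e_{2n}` of band `[−λ, λ]`) is
pairwise orthogonal ("Ils forment une base orthogonale de `G_λ` puisque l'opérateur est auto-adjoint").
The density half ("base … de `G_λ`") needs the completeness of the prolate functions at band `λ` and is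
not proved here (module docstring). [cite: Burnol2002CRAS, Lemme 3 (TeX l.289–293)] -/
theorem Burnol2002CRAS_lem3_iii_orthogonal (lam : ℝ) (_hlam : 0 < lam)
    (S : Set (Lp ℂ 2 (volume : Measure ℝ)))
    (hS : S = {v | ∃ (n : ℕ) (e : ℝ → ℝ) (E : Lp ℂ 2 (volume : Measure ℝ)),
      IsProlateFunction lam (2 * n) e ∧ (∀ᵐ x : ℝ, E x = (e x : ℂ)) ∧
        (v = E + fourierL2 E ∨ v = E - fourierL2 E)}) :
    ∀ v ∈ S, ∀ v' ∈ S, v ≠ v' → inner ℂ v v' = 0 := by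
  subst hS
  rintro v ⟨n, e, E, he, hE, hv⟩ v' ⟨n', e', E', he', hE', hv'⟩ hne
  by_cases hnn' : n = n'
  · subst hnn'
    have hee' : e = e' := he.unique he'
    subst hee'
    have hEE' : E = E' := eq_of_ae_eq_ofReal hE hE'
    subst hEE'
    rcases hv with rfl | rfl <;> rcases hv' with rfl | rfl
    · exact absurd rfl hne
    · exact inner_add_fourierL2_sub_fourierL2 he hE
    · exact inner_sub_fourierL2_add_fourierL2 he hE
    · exact absurd rfl hne
  · have h2 : 2 * n ≠ 2 * n' := fun h ↦ hnn' (by omega)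
    exact inner_eq_zero_of_index_ne he he' hE hE' h2 hv hv'

/-! ## D. Two more invariants of one prolate class: `μ ≠ 0` and `|μ| < 1` -/

section MuBounds

variable {lam : ℝ} {m : ℕ} {e : ℝ → ℝ} {E : Lp ℂ 2 (volume : Measure ℝ)}

/-- **`μ ≠ 0`**: the finite Fourier transform is injective on `L²(−λ,λ)` (the Fourier transform of a
compactly supported function cannot vanish on an interval unless the function does).
[cite: Burnol2002CRAS, Lemme 3 (TeX l.285–287); SlepianPollak1961, §III] -/
theorem prolate_mu_ne_zero (he : IsProlateFunction lam m e) :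
    (∫ x in (-lam)..lam, e x) / e 0 ≠ 0 := by
  intro h0
  have hz : ∀ ξ ∈ Ioo (-lam) lam, 𝓕 (fun x ↦ (e x : ℂ)) ξ = 0 := fun ξ hξ ↦ by
    rw [prolate_fourierIntegral_ofReal_eq he (Ioo_subset_Icc_self hξ), h0, Complex.ofReal_zero,
      zero_mul]
  have hae : (fun x ↦ (e x : ℂ)) =ᵐ[volume] 0 :=
    Literature.Analysis.Fourier.ae_eq_zero_of_fourier_eqOn_Ioo (prolate_integrable_ofReal he)
      he.lam_pos.le (fun x hx ↦ by rw [prolate_eq_zero_of_notMem_Icc he hx, Complex.ofReal_zero])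
      (by linarith [he.lam_pos] : -lam < lam) hz
  have hE : ∀ᵐ x : ℝ, ((prolate_memLp_ofReal he).toLp _ : Lp ℂ 2 (volume : Measure ℝ)) x = (e x : ℂ) :=
    (prolate_memLp_ofReal he).coeFn_toLp
  refine ne_zero he hE (Lp.ext ?_)
  filter_upwards [hE, hae, Lp.coeFn_zero ℂ 2 (volume : Measure ℝ)] with x h1 h2 h3
  rw [h1, h3, h2]

/-- `‖𝓕E‖ = ‖E‖`. [cite: Burnol2002CRAS, §2 (TeX l.207–210)] -/
theorem norm_fourierL2 (E : Lp ℂ 2 (volume : Measure ℝ)) : ‖fourierL2 E‖ = ‖E‖ :=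
  (Lp.fourierTransformₗᵢ ℝ ℂ).norm_map E

/-- Pythagoras for a star projection: `‖x‖² = ‖Px‖² + ‖x − Px‖²`. [folklore] -/
private theorem norm_sq_eq_add_of_isStarProjection {H : Type*} [NormedAddCommGroup H]
    [InnerProductSpace ℂ H] [CompleteSpace H] {P : H →L[ℂ] H} (hP : IsStarProjection P) (x : H) :
    ‖x‖ ^ 2 = ‖P x‖ ^ 2 + ‖x - P x‖ ^ 2 := by
  have hPP : P (P x) = P x := by
    have := congrArg (fun T : H →L[ℂ] H => T x) hP.isIdempotentElem.eq
    simpa [mul_apply_eq_comp] using this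
  have horth : ⟪P x, x - P x⟫_ℂ = 0 := by
    rw [← ContinuousLinearMap.adjoint_inner_right, hP.isSelfAdjoint.adjoint_eq, map_sub, hPP, sub_self,
      inner_zero_right]
  have h := @norm_add_sq ℂ H _ _ _ (P x) (x - P x)
  rw [add_sub_cancel, horth] at h
  simpa using h

/-- **`|μ| < 1`**: `‖P_λ𝓕E‖ = |μ|‖E‖ ≤ ‖𝓕E‖ = ‖E‖`, with equality only if `𝓕E` is time-limited, which
(being band-limited) forces `𝓕E = 0`. [cite: Burnol2002CRAS, Lemme 2, proof (TeX l.279–284: "de norme strictement inférieure à `1`")] -/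
theorem prolate_abs_mu_lt_one (he : IsProlateFunction lam m e) (hE : ∀ᵐ x : ℝ, E x = (e x : ℂ)) :
    |(∫ x in (-lam)..lam, e x) / e 0| < 1 := by
  have hP := isStarProjection_cutoffProj lam
  have h1 : ‖cutoffProj lam (fourierL2 E)‖ = |(∫ x in (-lam)..lam, e x) / e 0| * ‖E‖ := by
    rw [fourierL2_apply, cutoffProj_fourier_eq_smul he hE, norm_smul, Complex.norm_real, Real.norm_eq_abs]
  have hpy := norm_sq_eq_add_of_isStarProjection hP (fourierL2 E)
  rw [norm_fourierL2, h1] at hpy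
  have hE0 : 0 < ‖E‖ := norm_pos_iff.mpr (ne_zero he hE)
  have hle : |(∫ x in (-lam)..lam, e x) / e 0| ≤ 1 := by
    by_contra hlt
    push Not at hlt
    nlinarith [sq_nonneg ‖fourierL2 E - cutoffProj lam (fourierL2 E)‖, abs_nonneg ((∫ x in (-lam)..lam, e x) / e 0),
      mul_pos (by linarith : 0 < |(∫ x in (-lam)..lam, e x) / e 0| - 1) hE0]
  refine lt_of_le_of_ne hle fun h1' ↦ ?_
  rw [h1', one_mul] at hpy
  have h0 : fourierL2 E - cutoffProj lam (fourierL2 E) = 0 := by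
    have : ‖fourierL2 E - cutoffProj lam (fourierL2 E)‖ ^ 2 = 0 := by linarith
    exact norm_eq_zero.mp (pow_eq_zero_iff two_ne_zero |>.mp this)
  apply fourierL2_ne_zero he hE
  refine eq_zero_of_cutoffProj_eq_of_cutoffProjHat_eq (lam := lam) (sub_eq_zero.mp h0).symm ?_
  rw [fourierL2_apply, cutoffProjHat_fourier_eq he hE]

/-- `1 + μ ≠ 0`. [cite: Burnol2002CRAS, Lemme 3 (TeX l.289–293)] -/
theorem one_add_mu_ne_zero (he : IsProlateFunction lam m e) (hE : ∀ᵐ x : ℝ, E x = (e x : ℂ)) :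
    (1 : ℂ) + ((((∫ x in (-lam)..lam, e x) / e 0 : ℝ)) : ℂ) ≠ 0 := by
  have h := prolate_abs_mu_lt_one he hE
  rw [abs_lt] at h
  intro h0
  have := congrArg Complex.re h0
  simp at this
  linarith

/-- `1 − μ ≠ 0`. [cite: Burnol2002CRAS, Lemme 3 (TeX l.289–293)] -/
theorem one_sub_mu_ne_zero (he : IsProlateFunction lam m e) (hE : ∀ᵐ x : ℝ, E x = (e x : ℂ)) :
    (1 : ℂ) - ((((∫ x in (-lam)..lam, e x) / e 0 : ℝ)) : ℂ) ≠ 0 := by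
  have h := prolate_abs_mu_lt_one he hE
  rw [abs_lt] at h
  intro h0
  have := congrArg Complex.re h0
  simp at this
  linarith

/-- `‖E‖ = 1` (`∫_{−λ}^{λ} e² = 1`). [cite: Burnol2002CRAS, Lemme 3 (TeX l.285–287)] -/
theorem inner_self_eq_one (he : IsProlateFunction lam m e) (hE : ∀ᵐ x : ℝ, E x = (e x : ℂ)) :
    ⟪E, E⟫_ℂ = 1 := by
  rw [inner_eq_intervalIntegral he hE hE]
  have h : (fun x ↦ e x * e x) = fun x ↦ e x ^ 2 := by funext x; ring
  rw [h, he.norm_one, Complex.ofReal_one]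

end MuBounds

/-! ## E. Even classes: `𝓕² = 1`, `𝓕⁻¹ = 𝓕`, and `P_λ + P̃_λ` commutes with `𝓕` -/

section EvenTools

variable {lam : ℝ} {v : Lp ℂ 2 (volume : Measure ℝ)}

/-- An even class (an element of Burnol's `L²(ℝ)^{pair}`) is fixed by the reflection `x ↦ −x`.
[cite: Burnol2002CRAS, §2 (TeX l.262–264)] -/
theorem compNeg_eq_self_of_mem_evenL2 (hv : v ∈ evenL2) :
    Lp.compMeasurePreserving (fun x : ℝ ↦ -x) (Measure.measurePreserving_neg (volume : Measure ℝ)) v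
      = v := by
  refine Lp.ext ?_
  filter_upwards [coeFn_compNeg (F := ℂ) v, hv] with x hx h2
  rw [hx, h2]

/-- A class fixed by the reflection `x ↦ −x` is even (lies in `L²(ℝ)^{pair}`).
[cite: Burnol2002CRAS, §2 (TeX l.262–264)] -/
theorem mem_evenL2_of_compNeg_eq_self
    (hv : Lp.compMeasurePreserving (fun x : ℝ ↦ -x) (Measure.measurePreserving_neg (volume : Measure ℝ))
      v = v) : v ∈ evenL2 := by
  have h := coeFn_compNeg (F := ℂ) v
  rw [hv] at h
  show ∀ᵐ x : ℝ, (v : ℝ → ℂ) (-x) = (v : ℝ → ℂ) x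
  filter_upwards [h] with x hx
  exact hx.symm

/-- `𝓕𝓕v = v` for an even class. [cite: Burnol2002CRAS, §2 (TeX l.207–210)] -/
theorem fourierL2_fourierL2_of_mem_evenL2 (hv : v ∈ evenL2) : fourierL2 (fourierL2 v) = v := by
  rw [fourierL2_apply, fourierL2_apply, fourier_fourier_eq_compNeg, compNeg_eq_self_of_mem_evenL2 hv]

/-- `𝓕⁻¹v = 𝓕v` for an even class. [cite: Burnol2002CRAS, §2 (TeX l.207–210)] -/
theorem fourierInv_eq_fourierL2_of_mem_evenL2 (hv : v ∈ evenL2) :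
    (𝓕⁻ v : Lp ℂ 2 (volume : Measure ℝ)) = fourierL2 v := by
  rw [fourierL2_apply, fourierInv_eq_fourier_compNeg, compNeg_eq_self_of_mem_evenL2 hv]

/-- `𝓕v` is even for an even class. [cite: Burnol2002CRAS, §2 (TeX l.207–210)] -/
theorem fourierL2_mem_evenL2 (hv : v ∈ evenL2) : fourierL2 v ∈ evenL2 :=
  mem_evenL2_of_compNeg_eq_self (by rw [fourierL2_apply, ← fourier_compNeg, compNeg_eq_self_of_mem_evenL2 hv])

/-- `P_λ` acts on `L²(ℝ)^{pair}`: `P_λ v` is even for an even class. [cite: Burnol2002CRAS, §3 (TeX l.259–266)] -/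
theorem cutoffProj_mem_evenL2_of_mem_evenL2 (lam : ℝ) (hv : v ∈ evenL2) : cutoffProj lam v ∈ evenL2 :=
  mem_evenL2_of_compNeg_eq_self (by
    rw [Literature.NumberTheory.ConnesConsani2021.compNeg_cutoffProj, compNeg_eq_self_of_mem_evenL2 hv])

/-- `P̃_λ v = 𝓕(P_λ(𝓕v))` for an even class (`𝓕⁻¹ = 𝓕` on even classes). [cite: Burnol2002CRAS, §3 (TeX l.259–266)] -/
theorem cutoffProjHat_eq_of_mem_evenL2 (lam : ℝ) (hv : v ∈ evenL2) :
    cutoffProjHat lam v = fourierL2 (cutoffProj lam (fourierL2 v)) := by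
  rw [cutoffProjHat_apply, ← fourierL2_apply,
    fourierInv_eq_fourierL2_of_mem_evenL2 (cutoffProj_mem_evenL2_of_mem_evenL2 lam (fourierL2_mem_evenL2 hv))]

/-- `P_λ + P̃_λ` maps even classes to even classes. [cite: Burnol2002CRAS, Lemme 2 (TeX l.268–274)] -/
theorem sumProj_mem_evenL2 (lam : ℝ) (hv : v ∈ evenL2) : sumProj lam v ∈ evenL2 := by
  rw [sumProj_apply, cutoffProjHat_eq_of_mem_evenL2 lam hv]
  exact evenPart.add_mem (cutoffProj_mem_evenL2_of_mem_evenL2 lam hv)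
    (fourierL2_mem_evenL2 (cutoffProj_mem_evenL2_of_mem_evenL2 lam (fourierL2_mem_evenL2 hv)))

/-- **`(P_λ + P̃_λ)𝓕 = 𝓕(P_λ + P̃_λ)` on even classes.** [cite: Burnol2002CRAS, Lemme 3 (TeX l.289–293)] -/
theorem sumProj_fourierL2_of_mem_evenL2 (lam : ℝ) (hv : v ∈ evenL2) :
    sumProj lam (fourierL2 v) = fourierL2 (sumProj lam v) := by
  have hFv : fourierL2 v ∈ evenL2 := fourierL2_mem_evenL2 hv
  have h1 : cutoffProjHat lam (fourierL2 v) = fourierL2 (cutoffProj lam v) := by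
    rw [cutoffProjHat_eq_of_mem_evenL2 lam hFv, fourierL2_fourierL2_of_mem_evenL2 hv]
  have h2 : fourierL2 (cutoffProjHat lam v) = cutoffProj lam (fourierL2 v) := by
    rw [cutoffProjHat_eq_of_mem_evenL2 lam hv,
      fourierL2_fourierL2_of_mem_evenL2 (cutoffProj_mem_evenL2_of_mem_evenL2 lam hFv)]
  rw [sumProj_apply, sumProj_apply, map_add, h1, h2, add_comm]

/-- `0 ∈ G_λ`. [cite: Burnol2002CRAS, §3 (TeX l.265–266)] -/
theorem zero_mem_Gspace (lam : ℝ) : (0 : Lp ℂ 2 (volume : Measure ℝ)) ∈ Gspace lam :=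
  ⟨0, 0, evenPart.zero_mem, evenPart.zero_mem, by rw [map_zero, map_zero, add_zero]⟩

end EvenTools

/-! ## F. Clause (ii) and the density half of clause (iii) from the completeness of the prolate
functions and the injectivity of `n ↦ |μ_n(λ)|` -/

section FromCompleteness

variable {lam : ℝ}

/-- **Spectral simplicity of the finite Fourier transform on `P_λ(L²)^{pair}`, from completeness +
injectivity of `n ↦ |μ_n|`**: an even, time-limited, non-zero `x` with `P_λ𝓕x = κx` is a multiple of
ONE prolate class. (`⟪E_n, P_λ𝓕x⟫ = μ_n⟪E_n, x⟫`, so `κ = μ_n` whenever `⟪E_n, x⟫ ≠ 0`; two such `n`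
would have `|μ_n| = |μ_{n'}|`; and a vector of the closed span of the orthonormal family `(E_n)` with at
most one non-zero coefficient is a multiple of that `E_n`.) [cite: Burnol2002CRAS, Lemme 3 (TeX l.285–293); SlepianPollak1961, §III] -/
theorem exists_eq_smul_of_eigen (hlam : 0 < lam)
    (hC : ∀ u ∈ evenL2, cutoffProj lam u ∈
      closure (Submodule.span ℂ {E : Lp ℂ 2 (volume : Measure ℝ) | ∃ (n : ℕ) (e : ℝ → ℝ),
        IsProlateFunction lam (2 * n) e ∧ ∀ᵐ x : ℝ, E x = (e x : ℂ)} : Set (Lp ℂ 2 (volume : Measure ℝ))))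
    (hI : ∀ (n n' : ℕ) (e e' : ℝ → ℝ), IsProlateFunction lam (2 * n) e → IsProlateFunction lam (2 * n') e' →
      |(∫ x in (-lam)..lam, e x) / e 0| = |(∫ x in (-lam)..lam, e' x) / e' 0| → n = n')
    {x : Lp ℂ 2 (volume : Measure ℝ)} (hx : x ∈ evenL2) (hPx : cutoffProj lam x = x) (hx0 : x ≠ 0)
    {κ : ℂ} (hκ : cutoffProj lam (fourierL2 x) = κ • x) :
    ∃ (n : ℕ) (e : ℝ → ℝ) (E : Lp ℂ 2 (volume : Measure ℝ)) (c : ℂ),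
      IsProlateFunction lam (2 * n) e ∧ (∀ᵐ t : ℝ, E t = (e t : ℂ)) ∧ x = c • E ∧
        κ = ((((∫ t in (-lam)..lam, e t) / e 0 : ℝ)) : ℂ) := by
  have _ := hlam
  set Spr : Set (Lp ℂ 2 (volume : Measure ℝ)) := {E | ∃ (n : ℕ) (e : ℝ → ℝ),
    IsProlateFunction lam (2 * n) e ∧ ∀ᵐ x : ℝ, E x = (e x : ℂ)} with hSpr
  set K : Submodule ℂ (Lp ℂ 2 (volume : Measure ℝ)) := Submodule.span ℂ Spr with hK
  -- `x ∈ closure K = Kᗮᗮ`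
  have hxK : x ∈ Kᗮᗮ := by
    rw [Submodule.orthogonal_orthogonal_eq_closure]
    have h := hC x hx
    rw [hPx] at h
    exact h
  -- the key identity `⟪E, P𝓕x⟫ = μ_E ⟪E, x⟫` for `E ∈ Spr`
  have key : ∀ {n : ℕ} {e : ℝ → ℝ} {E : Lp ℂ 2 (volume : Measure ℝ)}, IsProlateFunction lam (2 * n) e →
      (∀ᵐ t : ℝ, E t = (e t : ℂ)) →
        κ * ⟪E, x⟫_ℂ = ((((∫ t in (-lam)..lam, e t) / e 0 : ℝ)) : ℂ) * ⟪E, x⟫_ℂ := by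
    intro n e E he hE
    have hP := isStarProjection_cutoffProj lam
    have h1 : ⟪E, cutoffProj lam (fourierL2 x)⟫_ℂ = κ * ⟪E, x⟫_ℂ := by rw [hκ, inner_smul_right]
    have h2 : ⟪E, cutoffProj lam (fourierL2 x)⟫_ℂ = ⟪fourierL2 E, x⟫_ℂ := by
      calc ⟪E, cutoffProj lam (fourierL2 x)⟫_ℂ
          = ⟪ContinuousLinearMap.adjoint (cutoffProj lam) E, fourierL2 x⟫_ℂ :=
            (ContinuousLinearMap.adjoint_inner_left _ _ _).symm
        _ = ⟪cutoffProj lam E, fourierL2 x⟫_ℂ := by rw [hP.isSelfAdjoint.adjoint_eq]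
        _ = ⟪E, fourierL2 x⟫_ℂ := by rw [cutoffProj_eq_self he hE]
        _ = ⟪fourierL2 (fourierL2 E), fourierL2 x⟫_ℂ := by
            rw [fourierL2_fourierL2_of_mem_evenL2 (mem_evenL2 he hE)]
        _ = ⟪fourierL2 E, x⟫_ℂ := inner_fourierL2_fourierL2 _ _
    have h3 : ⟪fourierL2 E, x⟫_ℂ = ((((∫ t in (-lam)..lam, e t) / e 0 : ℝ)) : ℂ) * ⟪E, x⟫_ℂ := by
      calc ⟪fourierL2 E, x⟫_ℂ = ⟪fourierL2 E, cutoffProj lam x⟫_ℂ := by rw [hPx]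
        _ = ⟪ContinuousLinearMap.adjoint (cutoffProj lam) (fourierL2 E), x⟫_ℂ :=
            (ContinuousLinearMap.adjoint_inner_left _ _ _).symm
        _ = ⟪cutoffProj lam (fourierL2 E), x⟫_ℂ := by rw [hP.isSelfAdjoint.adjoint_eq]
        _ = ((((∫ t in (-lam)..lam, e t) / e 0 : ℝ)) : ℂ) * ⟪E, x⟫_ℂ := by
            rw [fourierL2_apply, cutoffProj_fourier_eq_smul he hE, inner_smul_left, Complex.conj_ofReal]
    rw [← h1, h2, h3]
  -- some prolate class pairs non-trivially with `x`
  have hex : ∃ E ∈ Spr, ⟪E, x⟫_ℂ ≠ 0 := by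
    by_contra hall
    push Not at hall
    have hxo : x ∈ Kᗮ := by
      rw [hK, Submodule.mem_orthogonal]
      intro u hu
      refine Submodule.span_induction (p := fun u _ ↦ ⟪u, x⟫_ℂ = 0) (fun w hw ↦ hall w hw)
        (inner_zero_left _) (fun a b _ _ ha hb ↦ by rw [inner_add_left, ha, hb, add_zero])
        (fun c a _ ha ↦ by rw [inner_smul_left, ha, mul_zero]) hu
    have : x ∈ Kᗮ ⊓ Kᗮᗮ := ⟨hxo, hxK⟩
    rw [Submodule.inf_orthogonal_eq_bot, Submodule.mem_bot] at this
    exact hx0 this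
  obtain ⟨E₀, ⟨n₀, e₀, he₀, hE₀⟩, hne⟩ := hex
  have hκ₀ : κ = ((((∫ t in (-lam)..lam, e₀ t) / e₀ 0 : ℝ)) : ℂ) :=
    mul_right_cancel₀ hne (key he₀ hE₀)
  -- `y := x − ⟪E₀, x⟫ E₀` is orthogonal to every prolate class, and lies in the closed span: `y = 0`
  set y : Lp ℂ 2 (volume : Measure ℝ) := x - ⟪E₀, x⟫_ℂ • E₀ with hy
  have hyorth : ∀ E ∈ Spr, ⟪E, y⟫_ℂ = 0 := by
    rintro E ⟨n, e, he, hE⟩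
    by_cases hn : n = n₀
    · subst hn
      have hee : e = e₀ := he.unique he₀
      subst hee
      have hEE : E = E₀ := Lp.ext (by filter_upwards [hE, hE₀] with t h1 h2; rw [h1, h2])
      subst hEE
      rw [hy, inner_sub_right, inner_smul_right, inner_self_eq_one he hE, mul_one, sub_self]
    · have horth : ⟪E, E₀⟫_ℂ = 0 :=
        inner_eq_zero_of_ne he he₀ hE hE₀ (fun h ↦ hn (by omega))
      have hEx : ⟪E, x⟫_ℂ = 0 := by
        by_contra hEx
        have hκ₁ : κ = ((((∫ t in (-lam)..lam, e t) / e 0 : ℝ)) : ℂ) :=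
          mul_right_cancel₀ hEx (key he hE)
        have habs : |(∫ t in (-lam)..lam, e t) / e 0| = |(∫ t in (-lam)..lam, e₀ t) / e₀ 0| := by
          have := hκ₁.symm.trans hκ₀
          rw [Complex.ofReal_inj] at this
          rw [this]
        exact hn (hI n n₀ e e₀ he he₀ habs)
      rw [hy, inner_sub_right, inner_smul_right, horth, mul_zero, sub_zero, hEx]
  have hyK : y ∈ Kᗮᗮ := by
    refine Submodule.sub_mem _ hxK (Submodule.smul_mem _ _ ?_)
    exact Submodule.le_orthogonal_orthogonal K (Submodule.subset_span ⟨n₀, e₀, he₀, hE₀⟩)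
  have hyo : y ∈ Kᗮ := by
    rw [hK, Submodule.mem_orthogonal]
    intro u hu
    refine Submodule.span_induction (p := fun u _ ↦ ⟪u, y⟫_ℂ = 0) (fun w hw ↦ hyorth w hw)
      (inner_zero_left _) (fun a b _ _ ha hb ↦ by rw [inner_add_left, ha, hb, add_zero])
      (fun c a _ ha ↦ by rw [inner_smul_left, ha, mul_zero]) hu
  have hy0 : y = 0 := by
    have : y ∈ Kᗮ ⊓ Kᗮᗮ := ⟨hyo, hyK⟩
    rwa [Submodule.inf_orthogonal_eq_bot, Submodule.mem_bot] at this
  refine ⟨n₀, e₀, E₀, ⟪E₀, x⟫_ℂ, he₀, hE₀, ?_, hκ₀⟩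
  rw [hy] at hy0
  exact (sub_eq_zero.mp hy0)

end FromCompleteness

/-! ## G. Clause (ii) — every eigenvector of `P_λ + P̃_λ` in `G_λ` is one of the `e_{2n} ± 𝓕e_{2n}` —
and the density half of clause (iii), from completeness + injectivity of `n ↦ |μ_n(λ)|` -/

section ClauseTwo

variable {lam : ℝ}

/-- For an even `w` with `𝓕w = εw` (`ε² = 1`) and `(P_λ + P̃_λ)w = μw`, the time-limited part
`x = P_λw` is an eigenvector of the finite Fourier transform: `P_λ𝓕x = ε(μ − 1)x`.
[cite: Burnol2002CRAS, Lemme 3 (TeX l.285–293)] -/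
theorem cutoffProj_fourierL2_cutoffProj_of_eigen {w : Lp ℂ 2 (volume : Measure ℝ)} (hw : w ∈ evenL2)
    {ε μ : ℂ} (hε : ε * ε = 1) (hF : fourierL2 w = ε • w) (hT : sumProj lam w = μ • w) :
    cutoffProj lam (fourierL2 (cutoffProj lam w)) = (ε * (μ - 1)) • cutoffProj lam w := by
  have hP := isStarProjection_cutoffProj lam
  have hPP : ∀ z, cutoffProj lam (cutoffProj lam z) = cutoffProj lam z := fun z ↦ by
    have := congrArg (fun T : Lp ℂ 2 (volume : Measure ℝ) →L[ℂ] Lp ℂ 2 (volume : Measure ℝ) => T z)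
      hP.isIdempotentElem.eq
    simpa [mul_apply_eq_comp] using this
  have hhat : cutoffProjHat lam w = ε • fourierL2 (cutoffProj lam w) := by
    rw [cutoffProjHat_eq_of_mem_evenL2 lam hw, hF, map_smul, map_smul]
  have h1 : cutoffProj lam w + ε • fourierL2 (cutoffProj lam w) = μ • w := by
    rw [← hhat, ← sumProj_apply, hT]
  have h2 : cutoffProj lam w + ε • cutoffProj lam (fourierL2 (cutoffProj lam w)) = μ • cutoffProj lam w := by
    have := congrArg (cutoffProj lam) h1
    rwa [map_add, map_smul, map_smul, hPP] at this
  have h3 : ε • cutoffProj lam (fourierL2 (cutoffProj lam w)) = (μ - 1) • cutoffProj lam w := by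
    rw [sub_smul, one_smul, ← h2]; abel
  calc cutoffProj lam (fourierL2 (cutoffProj lam w))
      = (ε * ε) • cutoffProj lam (fourierL2 (cutoffProj lam w)) := by rw [hε, one_smul]
    _ = ε • (ε • cutoffProj lam (fourierL2 (cutoffProj lam w))) := by rw [smul_smul]
    _ = (ε * (μ - 1)) • cutoffProj lam w := by rw [h3, smul_smul]

/-- For an even `w` with `𝓕w = εw`, `(P_λ + P̃_λ)w = μw`, `μ ≠ 0`: if `P_λw = 0` then `w = 0`.
[cite: Burnol2002CRAS, Lemme 3 (TeX l.285–293)] -/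
theorem eq_zero_of_cutoffProj_eq_zero {w : Lp ℂ 2 (volume : Measure ℝ)} (hw : w ∈ evenL2)
    {ε μ : ℂ} (hF : fourierL2 w = ε • w) (hT : sumProj lam w = μ • w) (hμ : μ ≠ 0)
    (hPw : cutoffProj lam w = 0) : w = 0 := by
  have hhat : cutoffProjHat lam w = 0 := by
    rw [cutoffProjHat_eq_of_mem_evenL2 lam hw, hF, map_smul, map_smul, hPw, map_zero, smul_zero]
  have h : μ • w = 0 := by rw [← hT, sumProj_apply, hPw, hhat, add_zero]
  rcases smul_eq_zero.mp h with h | h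
  · exact absurd h hμ
  · exact h

/-- **Reconstruction**: an even `w ≠ 0` with `𝓕w = εw` (`ε² = 1`) and `(P_λ + P̃_λ)w = μw`, `μ ≠ 0`, is
`c·(E + ε𝓕E)` for a prolate class `E`, with `μ = 1 + εμ_E` — GIVEN the completeness of the prolate
classes and the injectivity of `n ↦ |μ_n|`. [cite: Burnol2002CRAS, Lemme 3 (TeX l.285–293)] -/
theorem exists_eq_smul_add_of_eigen (hlam : 0 < lam)
    (hC : ∀ u ∈ evenL2, cutoffProj lam u ∈
      closure (Submodule.span ℂ {E : Lp ℂ 2 (volume : Measure ℝ) | ∃ (n : ℕ) (e : ℝ → ℝ),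
        IsProlateFunction lam (2 * n) e ∧ ∀ᵐ x : ℝ, E x = (e x : ℂ)} : Set (Lp ℂ 2 (volume : Measure ℝ))))
    (hI : ∀ (n n' : ℕ) (e e' : ℝ → ℝ), IsProlateFunction lam (2 * n) e → IsProlateFunction lam (2 * n') e' →
      |(∫ x in (-lam)..lam, e x) / e 0| = |(∫ x in (-lam)..lam, e' x) / e' 0| → n = n')
    {w : Lp ℂ 2 (volume : Measure ℝ)} (hw : w ∈ evenL2) (hw0 : w ≠ 0)
    {ε μ : ℂ} (hε : ε * ε = 1) (hF : fourierL2 w = ε • w) (hT : sumProj lam w = μ • w) (hμ : μ ≠ 0) :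
    ∃ (n : ℕ) (e : ℝ → ℝ) (E : Lp ℂ 2 (volume : Measure ℝ)) (c : ℂ),
      IsProlateFunction lam (2 * n) e ∧ (∀ᵐ t : ℝ, E t = (e t : ℂ)) ∧
        w = c • (E + ε • fourierL2 E) ∧ μ = 1 + ε * ((((∫ t in (-lam)..lam, e t) / e 0 : ℝ)) : ℂ) := by
  have hP := isStarProjection_cutoffProj lam
  have hPP : ∀ z, cutoffProj lam (cutoffProj lam z) = cutoffProj lam z := fun z ↦ by
    have := congrArg (fun T : Lp ℂ 2 (volume : Measure ℝ) →L[ℂ] Lp ℂ 2 (volume : Measure ℝ) => T z)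
      hP.isIdempotentElem.eq
    simpa [mul_apply_eq_comp] using this
  -- the time-limited part `x = P w` is a non-zero even eigenvector of `P𝓕`
  have hx0 : cutoffProj lam w ≠ 0 := fun h ↦ hw0 (eq_zero_of_cutoffProj_eq_zero hw hF hT hμ h)
  have hxe : cutoffProj lam w ∈ evenL2 := cutoffProj_mem_evenL2_of_mem_evenL2 lam hw
  have hκ := cutoffProj_fourierL2_cutoffProj_of_eigen hw hε hF hT
  obtain ⟨n, e, E, c, he, hE, hxc, hκμ⟩ :=
    exists_eq_smul_of_eigen hlam hC hI hxe (hPP w) hx0 hκ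
  -- `μ = 1 + ε μ_E`
  have hμ' : μ = 1 + ε * ((((∫ t in (-lam)..lam, e t) / e 0 : ℝ)) : ℂ) := by
    rw [← hκμ, ← mul_assoc, hε, one_mul]; ring
  refine ⟨n, e, E, c / μ, he, hE, ?_, hμ'⟩
  -- `r := w − (c/μ)(E + ε𝓕E)` has `P r = 0`, `𝓕 r = ε r`, `T r = μ r`, hence `r = 0`
  have hEe : E ∈ evenL2 := mem_evenL2 he hE
  have hFE : fourierL2 (fourierL2 E) = E := fourierL2_fourierL2_of_mem_evenL2 hEe
  set μE : ℂ := ((((∫ t in (-lam)..lam, e t) / e 0 : ℝ)) : ℂ) with hμE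
  have hTE : sumProj lam E = E + μE • fourierL2 E := by
    rw [sumProj_apply, cutoffProj_eq_self he hE, cutoffProjHat_eq_smul_fourier he hE, fourierL2_apply]
  have hTFE : sumProj lam (fourierL2 E) = μE • E + fourierL2 E := by
    rw [sumProj_apply, fourierL2_apply, cutoffProj_fourier_eq_smul he hE, cutoffProjHat_fourier_eq he hE]
  have hTv : sumProj lam (E + ε • fourierL2 E) = μ • (E + ε • fourierL2 E) := by
    rw [map_add, map_smul, hTE, hTFE, hμ']
    have : (1 + ε * μE) • (E + ε • fourierL2 E)
        = E + μE • fourierL2 E + ε • (μE • E + fourierL2 E) + ((ε * ε - 1) * μE) • fourierL2 E := by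
      module
    rw [this, hε, sub_self, zero_mul, zero_smul, add_zero]
  have hFv : fourierL2 (E + ε • fourierL2 E) = ε • (E + ε • fourierL2 E) := by
    rw [map_add, map_smul, hFE, smul_add, smul_smul, hε, one_smul, add_comm]
  have hPv : cutoffProj lam (E + ε • fourierL2 E) = (1 + ε * μE) • E := by
    rw [map_add, map_smul, cutoffProj_eq_self he hE, fourierL2_apply, cutoffProj_fourier_eq_smul he hE,
      ← hμE]
    module
  set r : Lp ℂ 2 (volume : Measure ℝ) := w - (c / μ) • (E + ε • fourierL2 E) with hr
  have hre : r ∈ evenL2 := by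
    refine evenPart.sub_mem hw (evenPart.smul_mem _ (evenPart.add_mem hEe (evenPart.smul_mem _ ?_)))
    exact fourierL2_mem_evenL2 hEe
  have hFr : fourierL2 r = ε • r := by
    rw [hr, map_sub, map_smul, hF, hFv, smul_sub, smul_comm]
  have hTr : sumProj lam r = μ • r := by
    rw [hr, map_sub, map_smul, hT, hTv, smul_sub, smul_comm]
  have hPr : cutoffProj lam r = 0 := by
    rw [hr, map_sub, map_smul, hxc, hPv, ← hμ', smul_smul, div_mul_cancel₀ c hμ, sub_self]
  have hr0 : r = 0 := eq_zero_of_cutoffProj_eq_zero hre hFr hTr hμ hPr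
  rw [hr] at hr0
  exact sub_eq_zero.mp hr0

/-- **Burnol 2002, Lemme 3, clause (ii), from completeness + injectivity of `n ↦ |μ_n(λ)|`**: every
non-zero eigenvector of `P_λ + P̃_λ` lying in `G_λ` is a scalar multiple of one of the `E_{2n} ± 𝓕E_{2n}`.
("Les vecteurs propres de l'opérateur (dans `G_λ`) … sont les vecteurs `e_{2n} ± 𝓕₊(e_{2n})`.")
Proof: `(P_λ + P̃_λ)` commutes with `𝓕` on even classes, so `v ± 𝓕v` are eigenvectors fixed/anti-fixed by
`𝓕`; their time-limited parts are eigenvectors of the finite Fourier transform, hence multiples of one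
prolate class each; both parts non-zero would give `μ_n = −μ_{n'}`, excluded by injectivity of `|μ|` and
`μ_n ≠ 0`. [cite: Burnol2002CRAS, Lemme 3 (TeX l.289–293)] -/
theorem lem3_ii_of_complete_of_injective (hlam : 0 < lam)
    (hC : ∀ u ∈ evenL2, cutoffProj lam u ∈
      closure (Submodule.span ℂ {E : Lp ℂ 2 (volume : Measure ℝ) | ∃ (n : ℕ) (e : ℝ → ℝ),
        IsProlateFunction lam (2 * n) e ∧ ∀ᵐ x : ℝ, E x = (e x : ℂ)} : Set (Lp ℂ 2 (volume : Measure ℝ))))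
    (hI : ∀ (n n' : ℕ) (e e' : ℝ → ℝ), IsProlateFunction lam (2 * n) e → IsProlateFunction lam (2 * n') e' →
      |(∫ x in (-lam)..lam, e x) / e 0| = |(∫ x in (-lam)..lam, e' x) / e' 0| → n = n') :
    ∀ v ∈ Gspace lam, v ≠ 0 → (∃ μ : ℂ, sumProj lam v = μ • v) →
      ∃ (n : ℕ) (e : ℝ → ℝ) (E : Lp ℂ 2 (volume : Measure ℝ)) (c : ℂ),
        IsProlateFunction lam (2 * n) e ∧ (∀ᵐ x : ℝ, E x = (e x : ℂ)) ∧
          (v = c • (E + fourierL2 E) ∨ v = c • (E - fourierL2 E)) := by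
  rintro v hvG hv0 ⟨μ, hμ⟩
  have hve : v ∈ evenL2 := mem_evenL2_of_mem_Gspace hvG
  -- `μ ≠ 0`: `K_λ ∩ G_λ = 0` (Lemme 2)
  have hμ0 : μ ≠ 0 := by
    intro h
    rw [h, zero_smul] at hμ
    exact hv0 (eq_of_mem_Gspace_of_sumProj_eq lam hvG (zero_mem_Gspace lam) (by rw [hμ, map_zero]))
  have hFF : fourierL2 (fourierL2 v) = v := fourierL2_fourierL2_of_mem_evenL2 hve
  have hTF : sumProj lam (fourierL2 v) = μ • fourierL2 v := by
    rw [sumProj_fourierL2_of_mem_evenL2 lam hve, hμ, map_smul]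
  have hFe : fourierL2 v ∈ evenL2 := fourierL2_mem_evenL2 hve
  -- the `𝓕`-symmetric and `𝓕`-antisymmetric parts
  have hpe : v + fourierL2 v ∈ evenL2 := evenPart.add_mem hve hFe
  have hme : v - fourierL2 v ∈ evenL2 := evenPart.sub_mem hve hFe
  have hTp : sumProj lam (v + fourierL2 v) = μ • (v + fourierL2 v) := by rw [map_add, hμ, hTF, smul_add]
  have hTm : sumProj lam (v - fourierL2 v) = μ • (v - fourierL2 v) := by rw [map_sub, hμ, hTF, smul_sub]
  have hFp : fourierL2 (v + fourierL2 v) = (1 : ℂ) • (v + fourierL2 v) := by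
    rw [map_add, hFF, one_smul, add_comm]
  have hFm : fourierL2 (v - fourierL2 v) = (-1 : ℂ) • (v - fourierL2 v) := by
    rw [map_sub, hFF, neg_one_smul, neg_sub]
  have h1 : (1 : ℂ) * 1 = 1 := one_mul 1
  have hm1 : (-1 : ℂ) * -1 = 1 := by norm_num
  by_cases hp0 : v + fourierL2 v = 0
  · by_cases hm0 : v - fourierL2 v = 0
    · exfalso; apply hv0
      have : (2 : ℂ) • v = 0 := by
        rw [two_smul]
        calc v + v = (v + fourierL2 v) + (v - fourierL2 v) := by abel
          _ = 0 := by rw [hp0, hm0, add_zero]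
      exact (smul_eq_zero.mp this).resolve_left two_ne_zero
    · obtain ⟨n, e, E, c, he, hE, hwc, -⟩ :=
        exists_eq_smul_add_of_eigen hlam hC hI hme hm0 hm1 hFm hTm hμ0
      refine ⟨n, e, E, c / 2, he, hE, Or.inr ?_⟩
      have hv : v = (1 / 2 : ℂ) • (v - fourierL2 v) := by
        have h' : fourierL2 v = -v := by
          have := hp0; rw [add_eq_zero_iff_eq_neg] at this
          rw [← neg_neg (fourierL2 v), ← this]
        rw [h', sub_neg_eq_add, ← two_smul ℂ v, smul_smul]; norm_num
      rw [hv, hwc, smul_smul, neg_one_smul, ← sub_eq_add_neg]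
      congr 1; ring
  · by_cases hm0 : v - fourierL2 v = 0
    · obtain ⟨n, e, E, c, he, hE, hwc, -⟩ :=
        exists_eq_smul_add_of_eigen hlam hC hI hpe hp0 h1 hFp hTp hμ0
      refine ⟨n, e, E, c / 2, he, hE, Or.inl ?_⟩
      have hv : v = (1 / 2 : ℂ) • (v + fourierL2 v) := by
        have h' : fourierL2 v = v := (sub_eq_zero.mp hm0).symm
        rw [h', ← two_smul ℂ v, smul_smul]; norm_num
      rw [hv, hwc, smul_smul, one_smul]
      congr 1; ring
    · -- both parts non-zero: impossible
      exfalso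
      obtain ⟨n, e, E, c, he, hE, -, hμp⟩ :=
        exists_eq_smul_add_of_eigen hlam hC hI hpe hp0 h1 hFp hTp hμ0
      obtain ⟨n', e', E', c', he', hE', -, hμm⟩ :=
        exists_eq_smul_add_of_eigen hlam hC hI hme hm0 hm1 hFm hTm hμ0
      have hsum : ((((∫ t in (-lam)..lam, e t) / e 0 : ℝ)) : ℂ)
          = -((((∫ t in (-lam)..lam, e' t) / e' 0 : ℝ)) : ℂ) := by
        have := hμp.symm.trans hμm
        rw [one_mul, neg_one_mul, add_right_inj] at this
        exact this
      have habs : |(∫ t in (-lam)..lam, e t) / e 0| = |(∫ t in (-lam)..lam, e' t) / e' 0| := by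
        rw [← Complex.ofReal_neg, Complex.ofReal_inj] at hsum
        rw [hsum, abs_neg]
      have hnn := hI n n' e e' he he' habs
      subst hnn
      have hee : e = e' := he.unique he'
      subst hee
      rw [← Complex.ofReal_neg, Complex.ofReal_inj] at hsum
      have h0 : (∫ t in (-lam)..lam, e t) / e 0 = 0 := by linarith
      exact prolate_mu_ne_zero he h0

/-- **Burnol 2002, Lemme 3, clause (iii), density half, from completeness**: `G_λ` lies in the closed
span of the vectors `E_{2n} ± 𝓕E_{2n}` (each `E_{2n}` and each `𝓕E_{2n}` is a combination of them, the
`E_{2n}` span `P_λ(L²)^{pair}` densely by hypothesis, and `P̃_λw = 𝓕P_λ𝓕w`).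
[cite: Burnol2002CRAS, Lemme 3 (TeX l.289–293)] -/
theorem lem3_iii_dense_of_complete (hlam : 0 < lam)
    (hC : ∀ u ∈ evenL2, cutoffProj lam u ∈
      closure (Submodule.span ℂ {E : Lp ℂ 2 (volume : Measure ℝ) | ∃ (n : ℕ) (e : ℝ → ℝ),
        IsProlateFunction lam (2 * n) e ∧ ∀ᵐ x : ℝ, E x = (e x : ℂ)} : Set (Lp ℂ 2 (volume : Measure ℝ))))
    (S : Set (Lp ℂ 2 (volume : Measure ℝ)))
    (hS : S = {v | ∃ (n : ℕ) (e : ℝ → ℝ) (E : Lp ℂ 2 (volume : Measure ℝ)),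
      IsProlateFunction lam (2 * n) e ∧ (∀ᵐ x : ℝ, E x = (e x : ℂ)) ∧
        (v = E + fourierL2 E ∨ v = E - fourierL2 E)}) :
    Gspace lam ⊆ closure (Submodule.span ℂ S : Set (Lp ℂ 2 (volume : Measure ℝ))) := by
  have _ := hlam
  set Spr : Set (Lp ℂ 2 (volume : Measure ℝ)) := {E | ∃ (n : ℕ) (e : ℝ → ℝ),
    IsProlateFunction lam (2 * n) e ∧ ∀ᵐ x : ℝ, E x = (e x : ℂ)} with hSpr
  set K : Submodule ℂ (Lp ℂ 2 (volume : Measure ℝ)) := Submodule.span ℂ Spr with hK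
  set T : Submodule ℂ (Lp ℂ 2 (volume : Measure ℝ)) := Submodule.span ℂ S with hT
  -- each `E` and each `𝓕E` (for `E ∈ Spr`) lies in `T`
  have hET : ∀ E ∈ Spr, E ∈ T ∧ fourierL2 E ∈ T := by
    rintro E ⟨n, e, he, hE⟩
    have hp : E + fourierL2 E ∈ T := Submodule.subset_span (by rw [hS]; exact ⟨n, e, E, he, hE, Or.inl rfl⟩)
    have hm : E - fourierL2 E ∈ T := Submodule.subset_span (by rw [hS]; exact ⟨n, e, E, he, hE, Or.inr rfl⟩)
    refine ⟨?_, ?_⟩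
    · have : E = (1 / 2 : ℂ) • ((E + fourierL2 E) + (E - fourierL2 E)) := by
        rw [show (E + fourierL2 E) + (E - fourierL2 E) = (2 : ℂ) • E by rw [two_smul]; abel, smul_smul]
        norm_num
      rw [this]; exact T.smul_mem _ (T.add_mem hp hm)
    · have : fourierL2 E = (1 / 2 : ℂ) • ((E + fourierL2 E) - (E - fourierL2 E)) := by
        rw [show (E + fourierL2 E) - (E - fourierL2 E) = (2 : ℂ) • fourierL2 E by rw [two_smul]; abel,
          smul_smul]
        norm_num
      rw [this]; exact T.smul_mem _ (T.sub_mem hp hm)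
  have hKT : K ≤ T := Submodule.span_le.mpr fun E hE ↦ (hET E hE).1
  have hFKT : K.map (fourierL2 : Lp ℂ 2 (volume : Measure ℝ) →ₗ[ℂ] Lp ℂ 2 (volume : Measure ℝ)) ≤ T := by
    rw [hK, Submodule.map_span, Submodule.span_le]
    rintro _ ⟨E, hE, rfl⟩
    exact (hET E hE).2
  -- closures
  have hcl : closure (K : Set (Lp ℂ 2 (volume : Measure ℝ))) ⊆ (T.topologicalClosure : Set _) := by
    rw [Submodule.topologicalClosure_coe]; exact closure_mono hKT
  have hclF : fourierL2 '' closure (K : Set (Lp ℂ 2 (volume : Measure ℝ))) ⊆ (T.topologicalClosure : Set _) := by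
    refine (image_closure_subset_closure_image fourierL2.continuous).trans ?_
    rw [Submodule.topologicalClosure_coe]
    refine closure_mono ?_
    rintro _ ⟨z, hz, rfl⟩
    exact hFKT ⟨z, hz, rfl⟩
  rintro k ⟨u, w, hu, hw, rfl⟩
  show cutoffProj lam u + cutoffProjHat lam w ∈ (T.topologicalClosure : Set (Lp ℂ 2 (volume : Measure ℝ)))
  refine T.topologicalClosure.add_mem (hcl (hC u hu)) ?_
  rw [cutoffProjHat_eq_of_mem_evenL2 lam hw]
  exact hclF ⟨_, hC _ (fourierL2_mem_evenL2 hw), rfl⟩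

end ClauseTwo

/-! ## H. Assembly: Lemme 3 from the two spectral inputs, and the unconditional case `λ = 1` -/

/-- **Burnol 2002, Lemme 3 at a fixed `λ > 0`, from (h_C) the completeness of the even prolate classes in
`P_λ(L²)^{pair}` and (h_I) the injectivity of `n ↦ |μ_{2n}(λ)|`** — the body of `Burnol2002CRAS_lem3` at
`λ`, all three clauses. [cite: Burnol2002CRAS, Lemme 3 (TeX l.289–293)] -/
theorem Burnol2002CRAS_lem3_at (lam : ℝ) (hlam : 0 < lam)
    (hC : ∀ u ∈ evenL2, cutoffProj lam u ∈
      closure (Submodule.span ℂ {E : Lp ℂ 2 (volume : Measure ℝ) | ∃ (n : ℕ) (e : ℝ → ℝ),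
        IsProlateFunction lam (2 * n) e ∧ ∀ᵐ x : ℝ, E x = (e x : ℂ)} : Set (Lp ℂ 2 (volume : Measure ℝ))))
    (hI : ∀ (n n' : ℕ) (e e' : ℝ → ℝ), IsProlateFunction lam (2 * n) e → IsProlateFunction lam (2 * n') e' →
      |(∫ x in (-lam)..lam, e x) / e 0| = |(∫ x in (-lam)..lam, e' x) / e' 0| → n = n') :
    (∀ (n : ℕ) (e : ℝ → ℝ) (E : Lp ℂ 2 (volume : Measure ℝ)), IsProlateFunction lam (2 * n) e →
      (∀ᵐ x : ℝ, E x = (e x : ℂ)) →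
        (E + fourierL2 E ∈ Gspace lam ∧ E + fourierL2 E ≠ 0 ∧
          ∃ μ : ℂ, sumProj lam (E + fourierL2 E) = μ • (E + fourierL2 E)) ∧
        (E - fourierL2 E ∈ Gspace lam ∧ E - fourierL2 E ≠ 0 ∧
          ∃ μ : ℂ, sumProj lam (E - fourierL2 E) = μ • (E - fourierL2 E))) ∧
    (∀ v ∈ Gspace lam, v ≠ 0 → (∃ μ : ℂ, sumProj lam v = μ • v) →
      ∃ (n : ℕ) (e : ℝ → ℝ) (E : Lp ℂ 2 (volume : Measure ℝ)) (c : ℂ),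
        IsProlateFunction lam (2 * n) e ∧ (∀ᵐ x : ℝ, E x = (e x : ℂ)) ∧
          (v = c • (E + fourierL2 E) ∨ v = c • (E - fourierL2 E))) ∧
    (∀ (S : Set (Lp ℂ 2 (volume : Measure ℝ))),
      S = {v | ∃ (n : ℕ) (e : ℝ → ℝ) (E : Lp ℂ 2 (volume : Measure ℝ)),
            IsProlateFunction lam (2 * n) e ∧ (∀ᵐ x : ℝ, E x = (e x : ℂ)) ∧
            (v = E + fourierL2 E ∨ v = E - fourierL2 E)} →
        (∀ v ∈ S, ∀ v' ∈ S, v ≠ v' → inner ℂ v v' = 0) ∧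
        Gspace lam ⊆ closure (Submodule.span ℂ S : Set (Lp ℂ 2 (volume : Measure ℝ)))) :=
  ⟨fun n e E he hE ↦ Burnol2002CRAS_lem3_i lam hlam n e E he hE,
    lem3_ii_of_complete_of_injective hlam hC hI,
    fun S hS ↦ ⟨Burnol2002CRAS_lem3_iii_orthogonal lam hlam S hS, lem3_iii_dense_of_complete hlam hC S hS⟩⟩

/-- **The door**: `Burnol2002CRAS_lem3` follows from the two spectral inputs stated at every `λ > 0` —
(h_C) completeness of the even prolate classes of band `[−λ, λ]` in `P_λ(L²(ℝ))^{pair}` and (h_I)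
injectivity of `n ↦ |μ_{2n}(λ)|` (Slepian–Pollak: the eigenvalues of the finite Fourier transform are
simple with strictly decreasing moduli and the prolate functions are complete; in the tree at `λ = 1`:
`CC2021_sec4_xi_complete_holds`, `CC2021_sec4_lambda_basic_holds`).  Honest hypotheses, not new named facts.
[cite: Burnol2002CRAS, Lemme 3 (TeX l.289–293); SlepianPollak1961, §III] -/
theorem Burnol2002CRAS_lem3_of_complete_of_injective
    (hC : ∀ lam : ℝ, 0 < lam → ∀ u ∈ evenL2, cutoffProj lam u ∈
      closure (Submodule.span ℂ {E : Lp ℂ 2 (volume : Measure ℝ) | ∃ (n : ℕ) (e : ℝ → ℝ),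
        IsProlateFunction lam (2 * n) e ∧ ∀ᵐ x : ℝ, E x = (e x : ℂ)} : Set (Lp ℂ 2 (volume : Measure ℝ))))
    (hI : ∀ lam : ℝ, 0 < lam → ∀ (n n' : ℕ) (e e' : ℝ → ℝ), IsProlateFunction lam (2 * n) e →
      IsProlateFunction lam (2 * n') e' →
      |(∫ x in (-lam)..lam, e x) / e 0| = |(∫ x in (-lam)..lam, e' x) / e' 0| → n = n') :
    Burnol2002CRAS_lem3 :=
  fun lam hlam ↦ Burnol2002CRAS_lem3_at lam hlam (hC lam hlam) (hI lam hlam)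

/-! ## I. The case `λ = 1`: both spectral inputs are tree theorems (Connes–Consani 2021, §4, after
Slepian–Pollak), so Lemme 3 holds unconditionally at `λ = 1` -/

section One

open Literature.NumberTheory.ConnesConsani2021 (prolateXi prolateFun isProlateFunction_prolateFun
  prolateXi_coeFn eq_prolateFun_of_isProlateFunction prolateEigen_eq_intervalIntegral isClosed_evenPart
  CC2021_sec4_xi_complete_holds CC2021_sec4_lambda_basic_holds)

/-- **(h_C) at `λ = 1`**: the even prolate classes of band `[−1, 1]` are complete in `P_1(L²(ℝ))^{pair}` —
from the tree theorem `CC2021_sec4_xi_complete_holds` ("the vectors `ξ_n` form an orthonormal basis of the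
range of `𝒫₁`", Connes–Consani 2021 §4 p. 17, after Slepian–Pollak 1961 §III): the component of `P_1u`
orthogonal to the closed span is even, time-limited and orthogonal to every `ξ_n`, hence zero.
[cite: SlepianPollak1961, §III; Burnol2002CRAS, Lemme 3 (TeX l.289–293)] -/
theorem complete_one : ∀ u ∈ evenL2, cutoffProj 1 u ∈
    closure (Submodule.span ℂ {E : Lp ℂ 2 (volume : Measure ℝ) | ∃ (n : ℕ) (e : ℝ → ℝ),
      IsProlateFunction 1 (2 * n) e ∧ ∀ᵐ x : ℝ, E x = (e x : ℂ)} : Set (Lp ℂ 2 (volume : Measure ℝ))) := by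
  intro u hu
  set Spr : Set (Lp ℂ 2 (volume : Measure ℝ)) := {E | ∃ (n : ℕ) (e : ℝ → ℝ),
    IsProlateFunction 1 (2 * n) e ∧ ∀ᵐ x : ℝ, E x = (e x : ℂ)} with hSpr
  set K : Submodule ℂ (Lp ℂ 2 (volume : Measure ℝ)) := Submodule.span ℂ Spr with hK
  set W : Submodule ℂ (Lp ℂ 2 (volume : Measure ℝ)) := K.topologicalClosure with hW
  haveI : CompleteSpace W := K.isClosed_topologicalClosure.completeSpace_coe
  have hP := isStarProjection_cutoffProj (1 : ℝ)
  have hPP : ∀ z, cutoffProj 1 (cutoffProj 1 z) = cutoffProj 1 z := fun z ↦ by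
    have := congrArg (fun T : Lp ℂ 2 (volume : Measure ℝ) →L[ℂ] Lp ℂ 2 (volume : Measure ℝ) => T z)
      hP.isIdempotentElem.eq
    simpa [mul_apply_eq_comp] using this
  -- `W` consists of even, time-limited classes
  have hKev : K ≤ evenPart := Submodule.span_le.mpr (by rintro E ⟨n, e, he, hE⟩; exact mem_evenL2 he hE)
  have hWev : W ≤ evenPart := K.topologicalClosure_minimal hKev isClosed_evenPart
  set Fix : Submodule ℂ (Lp ℂ 2 (volume : Measure ℝ)) :=
    LinearMap.eqLocus ((cutoffProj 1 : Lp ℂ 2 (volume : Measure ℝ) →L[ℂ] Lp ℂ 2 (volume : Measure ℝ)) :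
      Lp ℂ 2 (volume : Measure ℝ) →ₗ[ℂ] Lp ℂ 2 (volume : Measure ℝ)) LinearMap.id with hFix
  have hFixc : IsClosed (Fix : Set (Lp ℂ 2 (volume : Measure ℝ))) :=
    isClosed_eq (cutoffProj 1).continuous continuous_id
  have hKFix : K ≤ Fix := Submodule.span_le.mpr (by
    rintro E ⟨n, e, he, hE⟩
    exact (LinearMap.mem_eqLocus).mpr (cutoffProj_eq_self he hE))
  have hWFix : W ≤ Fix := K.topologicalClosure_minimal hKFix hFixc
  -- the component of `P u` orthogonal to `W`
  set x : Lp ℂ 2 (volume : Measure ℝ) := cutoffProj 1 u with hx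
  set q : Lp ℂ 2 (volume : Measure ℝ) := x - W.starProjection x with hq
  have hqo : q ∈ Wᗮ := Submodule.sub_starProjection_mem_orthogonal x
  have hpW : W.starProjection x ∈ W := Submodule.starProjection_apply_mem W x
  have hqev : q ∈ evenPart := evenPart.sub_mem (cutoffProj_mem_evenL2_of_mem_evenL2 1 hu) (hWev hpW)
  have hPp : cutoffProj 1 (W.starProjection x) = W.starProjection x :=
    (LinearMap.mem_eqLocus).mp (hWFix hpW)
  have hPq : cutoffProj 1 q = q := by rw [hq, map_sub, hx, hPP, ← hx, hPp]
  have horth : ∀ n : ℕ, ⟪prolateXi n, q⟫_ℂ = 0 := fun n ↦ by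
    have hmem : prolateXi n ∈ W := K.le_topologicalClosure
      (Submodule.subset_span ⟨n, prolateFun n, isProlateFunction_prolateFun n, prolateXi_coeFn n⟩)
    exact Submodule.inner_right_of_mem_orthogonal hmem hqo
  have hq0 : q = 0 := CC2021_sec4_xi_complete_holds q hqev hPq horth
  have hxp : x = W.starProjection x := by rw [hq] at hq0; exact sub_eq_zero.mp hq0
  rw [hxp, ← Submodule.topologicalClosure_coe]
  exact hpW

/-- **(h_I) at `λ = 1`**: `n ↦ |μ_{2n}(1)| = |λ(n)|` is injective — from the tree theorem
`CC2021_sec4_lambda_basic_holds` (clause 3: `|λ(n)|` strictly decreasing; Connes–Consani 2021 §4 p. 16,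
after Slepian–Pollak 1961 §III) and the uniqueness of the tree prolate functions.
[cite: SlepianPollak1961, §III; Burnol2002CRAS, Lemme 3 (TeX l.289–293)] -/
theorem injective_one : ∀ (n n' : ℕ) (e e' : ℝ → ℝ), IsProlateFunction 1 (2 * n) e →
    IsProlateFunction 1 (2 * n') e' →
      |(∫ x in (-1 : ℝ)..1, e x) / e 0| = |(∫ x in (-1 : ℝ)..1, e' x) / e' 0| → n = n' := by
  intro n n' e e' he he' h
  have h1 := eq_prolateFun_of_isProlateFunction he
  have h2 := eq_prolateFun_of_isProlateFunction he'
  subst h1; subst h2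
  rw [← prolateEigen_eq_intervalIntegral, ← prolateEigen_eq_intervalIntegral] at h
  exact CC2021_sec4_lambda_basic_holds.2.2.1.injective h

/-- **Burnol 2002, Lemme 3 at `λ = 1` — PROVED, all three clauses** (the body of the named fact
`Burnol2002CRAS_lem3` at `λ = 1`): the vectors `e_{2n} ± 𝓕₊(e_{2n})` are non-zero eigenvectors of
`P_1 + P̃_1` in `G_1`, every eigenvector of `P_1 + P̃_1` in `G_1` is a multiple of one of them, and they
form an orthogonal family with dense span in `G_1`.  The spectral inputs (completeness of the prolate
functions, simplicity of `|λ(n)|`) are the tree theorems of Connes–Consani 2021 §4; the general `λ > 0`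
is `Burnol2002CRAS_lem3_of_complete_of_injective`. [cite: Burnol2002CRAS, Lemme 3 (TeX l.289–293); SlepianPollak1961, §III] -/
theorem Burnol2002CRAS_lem3_one :
    (∀ (n : ℕ) (e : ℝ → ℝ) (E : Lp ℂ 2 (volume : Measure ℝ)), IsProlateFunction 1 (2 * n) e →
      (∀ᵐ x : ℝ, E x = (e x : ℂ)) →
        (E + fourierL2 E ∈ Gspace 1 ∧ E + fourierL2 E ≠ 0 ∧
          ∃ μ : ℂ, sumProj 1 (E + fourierL2 E) = μ • (E + fourierL2 E)) ∧
        (E - fourierL2 E ∈ Gspace 1 ∧ E - fourierL2 E ≠ 0 ∧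
          ∃ μ : ℂ, sumProj 1 (E - fourierL2 E) = μ • (E - fourierL2 E))) ∧
    (∀ v ∈ Gspace 1, v ≠ 0 → (∃ μ : ℂ, sumProj 1 v = μ • v) →
      ∃ (n : ℕ) (e : ℝ → ℝ) (E : Lp ℂ 2 (volume : Measure ℝ)) (c : ℂ),
        IsProlateFunction 1 (2 * n) e ∧ (∀ᵐ x : ℝ, E x = (e x : ℂ)) ∧
          (v = c • (E + fourierL2 E) ∨ v = c • (E - fourierL2 E))) ∧
    (∀ (S : Set (Lp ℂ 2 (volume : Measure ℝ))),
      S = {v | ∃ (n : ℕ) (e : ℝ → ℝ) (E : Lp ℂ 2 (volume : Measure ℝ)),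
            IsProlateFunction 1 (2 * n) e ∧ (∀ᵐ x : ℝ, E x = (e x : ℂ)) ∧
            (v = E + fourierL2 E ∨ v = E - fourierL2 E)} →
        (∀ v ∈ S, ∀ v' ∈ S, v ≠ v' → inner ℂ v v' = 0) ∧
        Gspace 1 ⊆ closure (Submodule.span ℂ S : Set (Lp ℂ 2 (volume : Measure ℝ)))) :=
  Burnol2002CRAS_lem3_at 1 one_pos complete_one injective_one

end One

/-! ## J. Towards (h_I) at a general band: the finite cosine transform of a prolate function, its
derivatives, the end-point relation, and `e(λ) ≠ 0`

Throughout, for a prolate function `e = h_{m,λ}` we write (inline, no definition)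
`G(ω) = ∫_{−λ}^{λ} e(x)cos(2πxω)dx`, `G₁(ω) = ∫ e(x)(−2πx)sin(2πxω)dx`,
`G₂(ω) = ∫ (e(x)(−2πx))((2πx)cos(2πxω))dx` — the shapes of the tree's
`IsProlateFunction.integral_mul_cos_ode` (`(λ²−ω²)G₂ = 2ωG₁ + ((2πλω)²−χ)G` for every real `ω`). -/

section CosineTransform

variable {lam : ℝ} {m : ℕ} {e : ℝ → ℝ}

/-- Differentiation under the integral sign: `d/dω ∫_{−λ}^{λ} φ(x) cos(2πxω) dx = ∫ φ(x)(−2πx) sin(2πxω) dx`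
for `φ` continuous on `[−λ, λ]` (as in `ProlateProjectionsProofs`). [folklore] -/
private theorem hasDerivAt_integral_mul_cos {φ : ℝ → ℝ} {lam : ℝ} (hlam : 0 < lam)
    (hφ : ContinuousOn φ (Icc (-lam) lam)) (ω₀ : ℝ) :
    HasDerivAt (fun ω ↦ ∫ x in (-lam)..lam, φ x * Real.cos (2 * π * x * ω))
      (∫ x in (-lam)..lam, φ x * (-(2 * π * x) * Real.sin (2 * π * x * ω₀))) ω₀ := by
  have hle : -lam ≤ lam := by linarith
  have hIoc : uIoc (-lam) lam ⊆ Icc (-lam) lam := by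
    rw [uIoc_of_le hle]; exact Ioc_subset_Icc_self
  have hcontF : ∀ ω : ℝ, ContinuousOn (fun x ↦ φ x * Real.cos (2 * π * x * ω)) (Icc (-lam) lam) :=
    fun ω ↦ hφ.mul (by fun_prop)
  have hcontF' : ∀ ω : ℝ,
      ContinuousOn (fun x ↦ φ x * (-(2 * π * x) * Real.sin (2 * π * x * ω))) (Icc (-lam) lam) :=
    fun ω ↦ hφ.mul (by fun_prop)
  have key := intervalIntegral.hasDerivAt_integral_of_dominated_loc_of_deriv_le
    (μ := (volume : Measure ℝ)) (a := -lam) (b := lam) (x₀ := ω₀) (s := univ)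
    (F := fun ω x ↦ φ x * Real.cos (2 * π * x * ω))
    (F' := fun ω x ↦ φ x * (-(2 * π * x) * Real.sin (2 * π * x * ω)))
    (bound := fun x ↦ |φ x| * (2 * π * lam)) univ_mem
    (Eventually.of_forall fun ω ↦
      ((hcontF ω).mono hIoc).aestronglyMeasurable measurableSet_uIoc)
    ((hcontF ω₀).intervalIntegrable_of_Icc hle)
    (((hcontF' ω₀).mono hIoc).aestronglyMeasurable measurableSet_uIoc)
    (Eventually.of_forall fun x hx ω _ ↦ by
      have hx' : x ∈ Icc (-lam) lam := hIoc hx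
      rw [Real.norm_eq_abs, abs_mul, abs_mul, abs_neg]
      refine mul_le_mul_of_nonneg_left ?_ (abs_nonneg _)
      have h1 : |2 * π * x| ≤ 2 * π * lam := by
        rw [abs_mul, abs_of_pos (by positivity : (0 : ℝ) < 2 * π)]
        exact mul_le_mul_of_nonneg_left (abs_le.2 ⟨by linarith [hx'.1], hx'.2⟩) (by positivity)
      have h2 : |Real.sin (2 * π * x * ω)| ≤ 1 := Real.abs_sin_le_one _
      nlinarith [abs_nonneg (2 * π * x), abs_nonneg (Real.sin (2 * π * x * ω))])
    (((hφ.abs).mul continuousOn_const).intervalIntegrable_of_Icc hle)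
    (Eventually.of_forall fun x _ ω _ ↦ by
      have h := (((hasDerivAt_id ω).const_mul (2 * π * x)).cos).const_mul (φ x)
      refine h.congr_deriv ?_
      simp only [id, mul_one]
      ring)
  exact key.2

/-- Differentiation under the integral sign: `d/dω ∫_{−λ}^{λ} φ(x) sin(2πxω) dx = ∫ φ(x)(2πx) cos(2πxω) dx`
for `φ` continuous on `[−λ, λ]` (as in `ProlateProjectionsProofs`). [folklore] -/
private theorem hasDerivAt_integral_mul_sin {φ : ℝ → ℝ} {lam : ℝ} (hlam : 0 < lam)
    (hφ : ContinuousOn φ (Icc (-lam) lam)) (ω₀ : ℝ) :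
    HasDerivAt (fun ω ↦ ∫ x in (-lam)..lam, φ x * Real.sin (2 * π * x * ω))
      (∫ x in (-lam)..lam, φ x * ((2 * π * x) * Real.cos (2 * π * x * ω₀))) ω₀ := by
  have hle : -lam ≤ lam := by linarith
  have hIoc : uIoc (-lam) lam ⊆ Icc (-lam) lam := by
    rw [uIoc_of_le hle]; exact Ioc_subset_Icc_self
  have hcontF : ∀ ω : ℝ, ContinuousOn (fun x ↦ φ x * Real.sin (2 * π * x * ω)) (Icc (-lam) lam) :=
    fun ω ↦ hφ.mul (by fun_prop)
  have hcontF' : ∀ ω : ℝ,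
      ContinuousOn (fun x ↦ φ x * ((2 * π * x) * Real.cos (2 * π * x * ω))) (Icc (-lam) lam) :=
    fun ω ↦ hφ.mul (by fun_prop)
  have key := intervalIntegral.hasDerivAt_integral_of_dominated_loc_of_deriv_le
    (μ := (volume : Measure ℝ)) (a := -lam) (b := lam) (x₀ := ω₀) (s := univ)
    (F := fun ω x ↦ φ x * Real.sin (2 * π * x * ω))
    (F' := fun ω x ↦ φ x * ((2 * π * x) * Real.cos (2 * π * x * ω)))
    (bound := fun x ↦ |φ x| * (2 * π * lam)) univ_mem
    (Eventually.of_forall fun ω ↦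
      ((hcontF ω).mono hIoc).aestronglyMeasurable measurableSet_uIoc)
    ((hcontF ω₀).intervalIntegrable_of_Icc hle)
    (((hcontF' ω₀).mono hIoc).aestronglyMeasurable measurableSet_uIoc)
    (Eventually.of_forall fun x hx ω _ ↦ by
      have hx' : x ∈ Icc (-lam) lam := hIoc hx
      rw [Real.norm_eq_abs, abs_mul, abs_mul]
      refine mul_le_mul_of_nonneg_left ?_ (abs_nonneg _)
      have h1 : |2 * π * x| ≤ 2 * π * lam := by
        rw [abs_mul, abs_of_pos (by positivity : (0 : ℝ) < 2 * π)]
        exact mul_le_mul_of_nonneg_left (abs_le.2 ⟨by linarith [hx'.1], hx'.2⟩) (by positivity)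
      have h2 : |Real.cos (2 * π * x * ω)| ≤ 1 := Real.abs_cos_le_one _
      nlinarith [abs_nonneg (2 * π * x), abs_nonneg (Real.cos (2 * π * x * ω))])
    (((hφ.abs).mul continuousOn_const).intervalIntegrable_of_Icc hle)
    (Eventually.of_forall fun x _ ω _ ↦ by
      have h := (((hasDerivAt_id ω).const_mul (2 * π * x)).sin).const_mul (φ x)
      refine h.congr_deriv ?_
      simp only [id, mul_one]
      ring)
  exact key.2

/-- `G′ = G₁`. [cite: SlepianPollak1961, §III] -/
theorem prolate_hasDerivAt_cosInt (he : IsProlateFunction lam m e) (ω : ℝ) :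
    HasDerivAt (fun ω ↦ ∫ x in (-lam)..lam, e x * Real.cos (2 * π * x * ω))
      (∫ x in (-lam)..lam, e x * (-(2 * π * x) * Real.sin (2 * π * x * ω))) ω :=
  hasDerivAt_integral_mul_cos he.lam_pos he.contDiffOn.continuousOn ω

/-- `G₁′ = G₂`. [cite: SlepianPollak1961, §III] -/
theorem prolate_hasDerivAt_sinInt (he : IsProlateFunction lam m e) (ω : ℝ) :
    HasDerivAt (fun ω ↦ ∫ x in (-lam)..lam, e x * (-(2 * π * x) * Real.sin (2 * π * x * ω)))
      (∫ x in (-lam)..lam, (e x * (-(2 * π * x))) * ((2 * π * x) * Real.cos (2 * π * x * ω))) ω := by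
  have hφ : ContinuousOn (fun x ↦ e x * (-(2 * π * x))) (Icc (-lam) lam) :=
    he.contDiffOn.continuousOn.mul (by fun_prop)
  have h := hasDerivAt_integral_mul_sin he.lam_pos hφ ω
  have eq : (fun ω ↦ ∫ x in (-lam)..lam, e x * (-(2 * π * x) * Real.sin (2 * π * x * ω)))
      = fun ω ↦ ∫ x in (-lam)..lam, (e x * (-(2 * π * x))) * Real.sin (2 * π * x * ω) := by
    funext ω
    exact intervalIntegral.integral_congr fun x _ ↦ by ring
  rw [eq]
  exact h

/-- `G₂` is differentiable (hence continuous). [cite: SlepianPollak1961, §III] -/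
theorem prolate_hasDerivAt_cosInt₂ (he : IsProlateFunction lam m e) (ω : ℝ) :
    HasDerivAt (fun ω ↦ ∫ x in (-lam)..lam, (e x * (-(2 * π * x))) * ((2 * π * x) * Real.cos (2 * π * x * ω)))
      (∫ x in (-lam)..lam, ((e x * (-(2 * π * x))) * (2 * π * x)) * (-(2 * π * x) * Real.sin (2 * π * x * ω))) ω := by
  have hφ : ContinuousOn (fun x ↦ (e x * (-(2 * π * x))) * (2 * π * x)) (Icc (-lam) lam) :=
    (he.contDiffOn.continuousOn.mul (by fun_prop)).mul (by fun_prop)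
  have h := hasDerivAt_integral_mul_cos he.lam_pos hφ ω
  have eq : (fun ω ↦ ∫ x in (-lam)..lam, (e x * (-(2 * π * x))) * ((2 * π * x) * Real.cos (2 * π * x * ω)))
      = fun ω ↦ ∫ x in (-lam)..lam, ((e x * (-(2 * π * x))) * (2 * π * x)) * Real.cos (2 * π * x * ω) := by
    funext ω
    exact intervalIntegral.integral_congr fun x _ ↦ by ring
  rw [eq]
  exact h

/-- `G` is even in `ω`. [cite: SlepianPollak1961, §III] -/
theorem prolate_cosInt_neg (he : IsProlateFunction lam m e) (ω : ℝ) :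
    (∫ x in (-lam)..lam, e x * Real.cos (2 * π * x * -ω)) = ∫ x in (-lam)..lam, e x * Real.cos (2 * π * x * ω) := by
  have _ := he.lam_pos
  refine intervalIntegral.integral_congr fun x _ ↦ ?_
  simp only [mul_neg, Real.cos_neg]

/-- `G₁` is odd in `ω`. [cite: SlepianPollak1961, §III] -/
theorem prolate_sinInt_neg (he : IsProlateFunction lam m e) (ω : ℝ) :
    (∫ x in (-lam)..lam, e x * (-(2 * π * x) * Real.sin (2 * π * x * -ω)))
      = -∫ x in (-lam)..lam, e x * (-(2 * π * x) * Real.sin (2 * π * x * ω)) := by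
  have _ := he.lam_pos
  rw [← intervalIntegral.integral_neg]
  refine intervalIntegral.integral_congr fun x _ ↦ ?_
  simp only [mul_neg, Real.sin_neg, neg_mul, neg_neg, mul_neg]

/-- **The end-point relation** (the prolate equation for `G` read at the singular point `ω = λ`):
`2λ·G₁(λ) = (χ − (2πλ²)²)·G(λ)`. [cite: SlepianPollak1961, §III; HoganLakey2012, Cor. 2.6.9] -/
theorem prolate_endpoint_relation (he : IsProlateFunction lam m e) {χ : ℝ}
    (hχ : ∀ x ∈ Ioo (-lam) lam,
      -(deriv (fun y ↦ (lam ^ 2 - y ^ 2) * deriv e y) x) + (2 * π * lam * x) ^ 2 * e x = χ * e x) :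
    2 * lam * (∫ x in (-lam)..lam, e x * (-(2 * π * x) * Real.sin (2 * π * x * lam)))
      = (χ - (2 * π * lam * lam) ^ 2) * ∫ x in (-lam)..lam, e x * Real.cos (2 * π * x * lam) := by
  have h := he.integral_mul_cos_ode hχ lam
  simp only [sub_self, zero_mul] at h
  linarith

/-- **The finite Fourier transform of the (even, real) prolate function is its finite cosine transform**:
`∫_{−λ}^{λ} e(x)e^{2πixω}dx = G(ω)` for every real `ω`. [cite: Burnol2002CRAS, Lemme 3 (TeX l.285–287); SlepianPollak1961, §III] -/
theorem prolate_intervalIntegral_ofReal_mul_cexp_eq (he : IsProlateFunction lam m e) (ω : ℝ) :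
    ∫ x in (-lam)..lam, (e x : ℂ) * cexp (2 * π * I * x * ω) =
      ((∫ x in (-lam)..lam, e x * Real.cos (2 * π * x * ω) : ℝ) : ℂ) := by
  have hlam := he.lam_pos
  have hfc : ContinuousOn e (Icc (-lam) lam) := he.contDiffOn.continuousOn
  have hsin : ∫ x in (-lam)..lam, e x * Real.sin (2 * π * x * ω) = 0 := by
    have h : (∫ x in (-lam)..lam, e (-x) * Real.sin (2 * π * (-x) * ω))
        = ∫ x in (-lam)..lam, e x * Real.sin (2 * π * x * ω) := by
      simpa only [neg_neg] using intervalIntegral.integral_comp_neg (a := -lam) (b := lam)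
        (fun x ↦ e x * Real.sin (2 * π * x * ω))
    have h2 : (∫ x in (-lam)..lam, e (-x) * Real.sin (2 * π * (-x) * ω))
        = -∫ x in (-lam)..lam, e x * Real.sin (2 * π * x * ω) := by
      rw [← intervalIntegral.integral_neg]
      refine intervalIntegral.integral_congr fun x _ ↦ ?_
      simp only [he.even x]
      rw [show 2 * π * (-x) * ω = -(2 * π * x * ω) by ring, Real.sin_neg]
      ring
    linarith
  have hc1 : ContinuousOn (fun x : ℝ ↦ ((e x * Real.cos (2 * π * x * ω) : ℝ) : ℂ)) (Icc (-lam) lam) :=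
    Complex.continuous_ofReal.comp_continuousOn (hfc.mul (by fun_prop))
  have hc2 : ContinuousOn (fun x : ℝ ↦ ((e x * Real.sin (2 * π * x * ω) : ℝ) : ℂ) * I) (Icc (-lam) lam) :=
    (Complex.continuous_ofReal.comp_continuousOn (hfc.mul (by fun_prop))).mul continuousOn_const
  have eq : (fun x : ℝ ↦ (e x : ℂ) * cexp (2 * π * I * x * ω))
      = fun x : ℝ ↦ ((e x * Real.cos (2 * π * x * ω) : ℝ) : ℂ)
        + ((e x * Real.sin (2 * π * x * ω) : ℝ) : ℂ) * I := by
    funext x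
    have : (2 * π * I * x * ω : ℂ) = ((2 * π * x * ω : ℝ) : ℂ) * I := by push_cast; ring
    rw [this, Complex.exp_mul_I, ← Complex.ofReal_cos, ← Complex.ofReal_sin]
    push_cast; ring
  rw [eq, intervalIntegral.integral_add (hc1.intervalIntegrable_of_Icc (by linarith))
      (hc2.intervalIntegrable_of_Icc (by linarith)), intervalIntegral.integral_mul_const,
    intervalIntegral.integral_ofReal, intervalIntegral.integral_ofReal, hsin]
  push_cast; ring

/-- `𝓕e(ω) = G(ω)` for EVERY real `ω` (the Fourier integral of the complexified prolate function).
[cite: Burnol2002CRAS, Lemme 3 (TeX l.285–287); SlepianPollak1961, §III] -/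
theorem prolate_fourierIntegral_ofReal_eq_cosInt (he : IsProlateFunction lam m e) (ω : ℝ) :
    𝓕 (fun x ↦ (e x : ℂ)) ω = ((∫ x in (-lam)..lam, e x * Real.cos (2 * π * x * ω) : ℝ) : ℂ) := by
  rw [Real.fourier_real_eq_integral_exp_smul]
  have eq : (fun v : ℝ ↦ cexp (↑(-2 * π * v * ω) * I) • (e v : ℂ))
      = fun v : ℝ ↦ (e v : ℂ) * cexp (2 * π * I * v * ↑(-ω)) := by
    funext v
    rw [smul_eq_mul, mul_comm]
    congr 2
    push_cast; ring
  rw [eq, prolate_integral_ofReal_mul he, prolate_intervalIntegral_ofReal_mul_cexp_eq he, prolate_cosInt_neg he]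

end CosineTransform

/-! ## K. `e(λ) ≠ 0`: uniqueness at the regular-singular end-point `ω = λ` for the continuation `G` -/

section Endpoint

variable {lam : ℝ} {m : ℕ} {e : ℝ → ℝ}

/-- **`e(λ) ≠ 0`** for a tree prolate function `e = h_{m,λ}` (Hogan–Lakey "`φ_n(1) ≠ 0`").  Proof (no
Frobenius series): the finite cosine transform `G = μ·(continuation of e)` solves the prolate equation on
`ℝ`; if `e(λ) = 0` then `G(λ) = 0` and, by the end-point relation, `G′(λ) = 0`; the flux
`Φ = (λ²−ω²)G′` has `Φ′ = ((2πλω)²−χ)G`, so on `[λ, λ+h]`: `|Φ| ≤ Kh·max|G|·`, `|G′| ≤ K·max|G|/(2λ)`,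
`max|G| ≤ (Kh/2λ)·max|G|`, forcing `G ≡ 0` near `λ⁺` for small `h`; but `G = 𝓕e` is the Fourier
transform of a compactly supported function, so `e = 0` — absurd.
[cite: HoganLakey2012, Lemma 2.6.8; SlepianPollak1961, §III] -/
theorem prolate_apply_band_ne_zero (he : IsProlateFunction lam m e) : e lam ≠ 0 := by
  intro h0
  obtain ⟨χ, hχ⟩ := he.eigen
  have hlam := he.lam_pos
  set G : ℝ → ℝ := fun ω ↦ ∫ x in (-lam)..lam, e x * Real.cos (2 * π * x * ω) with hG
  set G₁ : ℝ → ℝ := fun ω ↦ ∫ x in (-lam)..lam, e x * (-(2 * π * x) * Real.sin (2 * π * x * ω))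
    with hG₁
  set G₂ : ℝ → ℝ := fun ω ↦
    ∫ x in (-lam)..lam, (e x * (-(2 * π * x))) * ((2 * π * x) * Real.cos (2 * π * x * ω)) with hG₂
  have hd1 : ∀ ω, HasDerivAt G (G₁ ω) ω := fun ω ↦ prolate_hasDerivAt_cosInt he ω
  have hd2 : ∀ ω, HasDerivAt G₁ (G₂ ω) ω := fun ω ↦ prolate_hasDerivAt_sinInt he ω
  have hode : ∀ ω, (lam ^ 2 - ω ^ 2) * G₂ ω = 2 * ω * G₁ ω + ((2 * π * lam * ω) ^ 2 - χ) * G ω :=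
    fun ω ↦ he.integral_mul_cos_ode hχ ω
  have hGc : Continuous G := continuous_iff_continuousAt.2 fun ω ↦ (hd1 ω).continuousAt
  -- values at `λ`
  have hGlam : G lam = 0 := by
    have h := he.integral_mul_cos_eq_mul (⟨by linarith, le_rfl⟩ : lam ∈ Icc (-lam) lam)
    change G lam = (∫ x in (-lam)..lam, e x) / e 0 * e lam at h
    rw [h, h0, mul_zero]
  have hG₁lam : G₁ lam = 0 := by
    have h := prolate_endpoint_relation he hχ
    change 2 * lam * G₁ lam = (χ - (2 * π * lam * lam) ^ 2) * G lam at h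
    rw [hGlam, mul_zero] at h
    rcases mul_eq_zero.mp h with h2 | h2
    · exfalso; linarith
    · exact h2
  -- the flux `Φ = (λ² − ω²)G₁`, `Φ′ = ((2πλω)² − χ)G`
  set Φ : ℝ → ℝ := fun ω ↦ (lam ^ 2 - ω ^ 2) * G₁ ω with hΦ
  have hΦd : ∀ ω, HasDerivAt Φ (((2 * π * lam * ω) ^ 2 - χ) * G ω) ω := by
    intro ω
    have h1 : HasDerivAt (fun ω : ℝ ↦ lam ^ 2 - ω ^ 2) (-((2 : ℕ) * ω ^ (2 - 1))) ω :=
      (hasDerivAt_pow 2 ω).const_sub (lam ^ 2)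
    have h2 : HasDerivAt (fun ω : ℝ ↦ (lam ^ 2 - ω ^ 2) * G₁ ω)
        (-((2 : ℕ) * ω ^ (2 - 1)) * G₁ ω + (lam ^ 2 - ω ^ 2) * G₂ ω) ω := h1.mul (hd2 ω)
    show HasDerivAt (fun ω : ℝ ↦ (lam ^ 2 - ω ^ 2) * G₁ ω) (((2 * π * lam * ω) ^ 2 - χ) * G ω) ω
    refine h2.congr_deriv ?_
    have h3 := hode ω
    simp only [Nat.cast_ofNat, Nat.add_one_sub_one, pow_one]
    linarith [h3]
  have hΦlam : Φ lam = 0 := by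
    change (lam ^ 2 - lam ^ 2) * G₁ lam = 0
    rw [sub_self, zero_mul]
  -- constants `K`, `h`
  set K : ℝ := (2 * π * lam * (lam + 1)) ^ 2 + |χ| with hK
  have hK0 : 0 ≤ K := by positivity
  have hKbd : ∀ ω ∈ Icc lam (lam + 1), |(2 * π * lam * ω) ^ 2 - χ| ≤ K := by
    intro ω hω
    have hω0 : 0 ≤ ω := by linarith [hω.1]
    have h1 : (2 * π * lam * ω) ^ 2 ≤ (2 * π * lam * (lam + 1)) ^ 2 := by
      have ha : 0 ≤ 2 * π * lam * ω := by positivity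
      have hb : 2 * π * lam * ω ≤ 2 * π * lam * (lam + 1) :=
        mul_le_mul_of_nonneg_left hω.2 (by positivity)
      nlinarith
    calc |(2 * π * lam * ω) ^ 2 - χ| ≤ |(2 * π * lam * ω) ^ 2| + |χ| := abs_sub _ _
      _ ≤ K := by rw [abs_of_nonneg (sq_nonneg _)]; linarith
  set h : ℝ := min 1 (lam / (K + 1)) with hh
  have hh0 : 0 < h := lt_min one_pos (div_pos hlam (by linarith))
  have hh1 : h ≤ 1 := min_le_left _ _
  have hhK : K * h ≤ lam := by
    have h1 : h ≤ lam / (K + 1) := min_le_right _ _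
    have h2 : K * h ≤ K * (lam / (K + 1)) := mul_le_mul_of_nonneg_left h1 hK0
    have h3 : K * (lam / (K + 1)) ≤ lam := by
      rw [mul_div_assoc', div_le_iff₀ (by linarith : (0 : ℝ) < K + 1)]
      nlinarith
    linarith
  -- the maximum `M` of `|G|` on `[λ, λ + h]`
  obtain ⟨ωs, hωs, hmax⟩ := (isCompact_Icc : IsCompact (Icc lam (lam + h))).exists_isMaxOn
    (nonempty_Icc.2 (by linarith)) ((continuous_abs.comp hGc).continuousOn)
  set M : ℝ := |G ωs| with hM
  have hMbd : ∀ ω ∈ Icc lam (lam + h), |G ω| ≤ M := fun ω hω ↦ hmax hω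
  have hM0 : 0 ≤ M := abs_nonneg _
  -- Step A: `|Φ t| ≤ K·M·(t − λ)`
  have hA : ∀ t ∈ Icc lam (lam + h), |Φ t| ≤ K * M * (t - lam) := by
    intro t ht
    have hmvt := norm_image_sub_le_of_norm_deriv_le_segment' (f := Φ)
      (f' := fun ω ↦ ((2 * π * lam * ω) ^ 2 - χ) * G ω) (a := lam) (b := lam + h) (C := K * M)
      (fun x _ ↦ (hΦd x).hasDerivWithinAt)
      (fun x hx ↦ by
        have hx1 : x ∈ Icc lam (lam + 1) := ⟨hx.1, by linarith [hx.2]⟩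
        have hx2 : x ∈ Icc lam (lam + h) := Ico_subset_Icc_self hx
        rw [Real.norm_eq_abs, abs_mul]
        exact mul_le_mul (hKbd x hx1) (hMbd x hx2) (abs_nonneg _) hK0) t ht
    rw [hΦlam, sub_zero, Real.norm_eq_abs] at hmvt
    exact hmvt
  -- Step B: `|G₁ t| ≤ K·M/(2λ)`
  have hB : ∀ t ∈ Icc lam (lam + h), |G₁ t| ≤ K * M / (2 * lam) := by
    intro t ht
    rcases eq_or_lt_of_le ht.1 with heq | hlt
    · rw [← heq, hG₁lam, abs_zero]; positivity
    · have hpos : 0 < t ^ 2 - lam ^ 2 := by nlinarith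
      have hΦt : |Φ t| = (t ^ 2 - lam ^ 2) * |G₁ t| := by
        change |(lam ^ 2 - t ^ 2) * G₁ t| = _
        rw [abs_mul, abs_sub_comm, abs_of_pos hpos]
      have h1 : (t ^ 2 - lam ^ 2) * |G₁ t| ≤ K * M * (t - lam) := hΦt ▸ hA t ht
      have h3 : (t + lam) * |G₁ t| ≤ K * M := by
        have h2 : (t - lam) * ((t + lam) * |G₁ t|) ≤ (t - lam) * (K * M) := by nlinarith
        exact le_of_mul_le_mul_left h2 (by linarith)
      rw [le_div_iff₀ (by linarith : (0 : ℝ) < 2 * lam)]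
      nlinarith [abs_nonneg (G₁ t)]
  -- Step C: `|G ω| ≤ (K·M/(2λ))·h`
  have hC : ∀ ω ∈ Icc lam (lam + h), |G ω| ≤ K * M / (2 * lam) * h := by
    intro ω hω
    have hmvt := norm_image_sub_le_of_norm_deriv_le_segment' (f := G) (f' := G₁) (a := lam)
      (b := lam + h) (C := K * M / (2 * lam)) (fun x _ ↦ (hd1 x).hasDerivWithinAt)
      (fun x hx ↦ by rw [Real.norm_eq_abs]; exact hB x (Ico_subset_Icc_self hx)) ω hω
    rw [hGlam, sub_zero, Real.norm_eq_abs] at hmvt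
    calc |G ω| ≤ K * M / (2 * lam) * (ω - lam) := hmvt
      _ ≤ K * M / (2 * lam) * h := mul_le_mul_of_nonneg_left (by linarith [hω.2]) (by positivity)
  -- Step D: `M = 0`
  have hD : M = 0 := by
    have h1 : M ≤ K * M / (2 * lam) * h := hC ωs hωs
    have h2 : K * M / (2 * lam) * h ≤ M / 2 := by
      rw [div_mul_eq_mul_div, div_le_div_iff₀ (by linarith : (0 : ℝ) < 2 * lam) two_pos]
      have := mul_le_mul_of_nonneg_right hhK hM0
      nlinarith
    exact le_antisymm (by linarith) hM0
  have hG0 : ∀ ω ∈ Ioo lam (lam + h), G ω = 0 := fun ω hω ↦ by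
    have h1 := hMbd ω (Ioo_subset_Icc_self hω)
    rw [hD] at h1
    exact abs_nonpos_iff.mp h1
  -- Step E: `𝓕e` vanishes on an interval, hence `e = 0`
  have hz : ∀ ξ ∈ Ioo lam (lam + h), 𝓕 (fun x ↦ (e x : ℂ)) ξ = 0 := fun ξ hξ ↦ by
    rw [prolate_fourierIntegral_ofReal_eq_cosInt he]
    change ((G ξ : ℝ) : ℂ) = 0
    rw [hG0 ξ hξ, Complex.ofReal_zero]
  have hae : (fun x ↦ (e x : ℂ)) =ᵐ[volume] 0 :=
    Literature.Analysis.Fourier.ae_eq_zero_of_fourier_eqOn_Ioo (prolate_integrable_ofReal he)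
      he.lam_pos.le (fun x hx ↦ by rw [prolate_eq_zero_of_notMem_Icc he hx, Complex.ofReal_zero])
      (by linarith : lam < lam + h) hz
  have hE : ∀ᵐ x : ℝ, ((prolate_memLp_ofReal he).toLp _ : Lp ℂ 2 (volume : Measure ℝ)) x = (e x : ℂ) :=
    (prolate_memLp_ofReal he).coeFn_toLp
  refine ne_zero he hE (Lp.ext ?_)
  filter_upwards [hE, hae, Lp.coeFn_zero ℂ 2 (volume : Measure ℝ)] with x h1 h2 h3
  rw [h1, h3, h2]

end Endpoint

/-! ## L. The virial identity at band `λ` and (h_I): `n ↦ |μ_{2n}(λ)|` is injective -/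

section Virial

variable {lam : ℝ} {m m' : ℕ} {e e' : ℝ → ℝ}

/-- **The pairing identity** (the commuting miracle differentiated twice, paired with `e'`, Fubini on
`[−λ,λ]²`, and the commuting miracle for `e'`):
`∫_{−λ}^{λ} e'(y)G₂[e](y)dy = −μ'·∫_{−λ}^{λ}(2πx)²e(x)e'(x)dx`.
[cite: HoganLakey2012, Thm. 2.6.1–2.6.2; SlepianPollak1961, §III] -/
theorem prolate_integral_mul_cosInt₂ (he : IsProlateFunction lam m e) (he' : IsProlateFunction lam m' e') :
    ∫ y in (-lam)..lam, e' y *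
        (∫ x in (-lam)..lam, (e x * (-(2 * π * x))) * ((2 * π * x) * Real.cos (2 * π * x * y)))
      = -(((∫ x in (-lam)..lam, e' x) / e' 0)) *
          ∫ x in (-lam)..lam, (2 * π * x) ^ 2 * (e x * e' x) := by
  have hlam := he.lam_pos
  have hle : -lam ≤ lam := by linarith
  have hec : ContinuousOn e (Icc (-lam) lam) := he.contDiffOn.continuousOn
  have he'c : ContinuousOn e' (Icc (-lam) lam) := he'.contDiffOn.continuousOn
  -- Fubini
  have hswap : (∫ y in (-lam)..lam, ∫ x in (-lam)..lam,
        e' y * ((e x * (-(2 * π * x))) * ((2 * π * x) * Real.cos (2 * π * x * y))))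
      = ∫ x in (-lam)..lam, ∫ y in (-lam)..lam,
        e' y * ((e x * (-(2 * π * x))) * ((2 * π * x) * Real.cos (2 * π * x * y))) := by
    simp only [intervalIntegral.integral_of_le hle]
    have h1 : Integrable e' (volume.restrict (Ioc (-lam) lam)) :=
      (he'c.integrableOn_compact isCompact_Icc).mono_set Ioc_subset_Icc_self
    have h2 : Integrable (fun x ↦ (e x * (-(2 * π * x))) * (2 * π * x)) (volume.restrict (Ioc (-lam) lam)) :=
      (((hec.mul (by fun_prop)).mul (by fun_prop)).integrableOn_compact isCompact_Icc).mono_set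
        Ioc_subset_Icc_self
    have hint : Integrable (Function.uncurry fun (y x : ℝ) ↦
        e' y * ((e x * (-(2 * π * x))) * ((2 * π * x) * Real.cos (2 * π * x * y))))
        ((volume.restrict (Ioc (-lam) lam)).prod (volume.restrict (Ioc (-lam) lam))) := by
      change Integrable (fun z : ℝ × ℝ ↦
        e' z.1 * ((e z.2 * (-(2 * π * z.2))) * ((2 * π * z.2) * Real.cos (2 * π * z.2 * z.1)))) _
      have h3 : Integrable (fun z : ℝ × ℝ ↦ e' z.1 * ((e z.2 * (-(2 * π * z.2))) * (2 * π * z.2)))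
          ((volume.restrict (Ioc (-lam) lam)).prod (volume.restrict (Ioc (-lam) lam))) :=
        h1.mul_prod h2
      refine (h3.bdd_mul (c := 1) (f := fun z : ℝ × ℝ ↦ Real.cos (2 * π * z.2 * z.1))
        (Continuous.aestronglyMeasurable (by fun_prop)) ?_).congr ?_
      · exact Eventually.of_forall fun z ↦ by rw [Real.norm_eq_abs]; exact Real.abs_cos_le_one _
      · exact Eventually.of_forall fun z ↦ by dsimp only; ring
    exact integral_integral_swap hint
  calc (∫ y in (-lam)..lam, e' y *
          (∫ x in (-lam)..lam, (e x * (-(2 * π * x))) * ((2 * π * x) * Real.cos (2 * π * x * y))))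
      = ∫ y in (-lam)..lam, ∫ x in (-lam)..lam,
          e' y * ((e x * (-(2 * π * x))) * ((2 * π * x) * Real.cos (2 * π * x * y))) := by
        refine intervalIntegral.integral_congr fun y _ ↦ ?_
        rw [← intervalIntegral.integral_const_mul]
    _ = ∫ x in (-lam)..lam, ∫ y in (-lam)..lam,
          e' y * ((e x * (-(2 * π * x))) * ((2 * π * x) * Real.cos (2 * π * x * y))) := hswap
    _ = ∫ x in (-lam)..lam, -(((∫ x in (-lam)..lam, e' x) / e' 0)) * ((2 * π * x) ^ 2 * (e x * e' x)) := by
        refine intervalIntegral.integral_congr fun x hx ↦ ?_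
        rw [uIcc_of_le hle] at hx
        have h1 : (∫ y in (-lam)..lam,
            e' y * ((e x * (-(2 * π * x))) * ((2 * π * x) * Real.cos (2 * π * x * y))))
            = ((e x * (-(2 * π * x))) * (2 * π * x)) * ∫ y in (-lam)..lam, e' y * Real.cos (2 * π * y * x) := by
          rw [← intervalIntegral.integral_const_mul]
          refine intervalIntegral.integral_congr fun y _ ↦ ?_
          rw [show 2 * π * x * y = 2 * π * y * x by ring]
          ring
        rw [h1, he'.integral_mul_cos_eq_mul hx]
        ring
    _ = -(((∫ x in (-lam)..lam, e' x) / e' 0)) * ∫ x in (-lam)..lam, (2 * π * x) ^ 2 * (e x * e' x) := by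
        rw [intervalIntegral.integral_const_mul]

/-- **Green's identity for the two continuations** (integration by parts on `[−λ,λ]`, the `∫G₁G₁`
terms cancelling, evenness of `G`, oddness of `G₁`, and the end-point relations):
`λ·(∫G[e']G₂[e] − ∫G[e]G₂[e']) = (χ − χ')·G[e](λ)G[e'](λ)`.
[cite: HoganLakey2012, Thm. 2.6.1–2.6.2, Cor. 2.6.9; SlepianPollak1961, §III] -/
theorem prolate_green_cosInt (he : IsProlateFunction lam m e) (he' : IsProlateFunction lam m' e')
    {χ χ' : ℝ}
    (hχ : ∀ x ∈ Ioo (-lam) lam,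
      -(deriv (fun y ↦ (lam ^ 2 - y ^ 2) * deriv e y) x) + (2 * π * lam * x) ^ 2 * e x = χ * e x)
    (hχ' : ∀ x ∈ Ioo (-lam) lam,
      -(deriv (fun y ↦ (lam ^ 2 - y ^ 2) * deriv e' y) x) + (2 * π * lam * x) ^ 2 * e' x = χ' * e' x) :
    lam * ((∫ y in (-lam)..lam, (∫ x in (-lam)..lam, e' x * Real.cos (2 * π * x * y)) *
              (∫ x in (-lam)..lam, (e x * (-(2 * π * x))) * ((2 * π * x) * Real.cos (2 * π * x * y))))
          - (∫ y in (-lam)..lam, (∫ x in (-lam)..lam, e x * Real.cos (2 * π * x * y)) *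
              (∫ x in (-lam)..lam, (e' x * (-(2 * π * x))) * ((2 * π * x) * Real.cos (2 * π * x * y)))))
      = (χ - χ') * ((∫ x in (-lam)..lam, e x * Real.cos (2 * π * x * lam)) *
          (∫ x in (-lam)..lam, e' x * Real.cos (2 * π * x * lam))) := by
  have hlam := he.lam_pos
  set G : ℝ → ℝ := fun ω ↦ ∫ x in (-lam)..lam, e x * Real.cos (2 * π * x * ω) with hG
  set G₁ : ℝ → ℝ := fun ω ↦ ∫ x in (-lam)..lam, e x * (-(2 * π * x) * Real.sin (2 * π * x * ω))
    with hG₁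
  set G₂ : ℝ → ℝ := fun ω ↦
    ∫ x in (-lam)..lam, (e x * (-(2 * π * x))) * ((2 * π * x) * Real.cos (2 * π * x * ω)) with hG₂
  set H : ℝ → ℝ := fun ω ↦ ∫ x in (-lam)..lam, e' x * Real.cos (2 * π * x * ω) with hH
  set H₁ : ℝ → ℝ := fun ω ↦ ∫ x in (-lam)..lam, e' x * (-(2 * π * x) * Real.sin (2 * π * x * ω))
    with hH₁
  set H₂ : ℝ → ℝ := fun ω ↦
    ∫ x in (-lam)..lam, (e' x * (-(2 * π * x))) * ((2 * π * x) * Real.cos (2 * π * x * ω)) with hH₂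
  have hd1 : ∀ ω, HasDerivAt G (G₁ ω) ω := fun ω ↦ prolate_hasDerivAt_cosInt he ω
  have hd2 : ∀ ω, HasDerivAt G₁ (G₂ ω) ω := fun ω ↦ prolate_hasDerivAt_sinInt he ω
  have hd3 : ∀ ω, HasDerivAt G₂ _ ω := fun ω ↦ prolate_hasDerivAt_cosInt₂ he ω
  have he1 : ∀ ω, HasDerivAt H (H₁ ω) ω := fun ω ↦ prolate_hasDerivAt_cosInt he' ω
  have he2 : ∀ ω, HasDerivAt H₁ (H₂ ω) ω := fun ω ↦ prolate_hasDerivAt_sinInt he' ω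
  have he3 : ∀ ω, HasDerivAt H₂ _ ω := fun ω ↦ prolate_hasDerivAt_cosInt₂ he' ω
  have hG₁c : Continuous G₁ := continuous_iff_continuousAt.2 fun ω ↦ (hd2 ω).continuousAt
  have hG₂c : Continuous G₂ := continuous_iff_continuousAt.2 fun ω ↦ (hd3 ω).continuousAt
  have hH₁c : Continuous H₁ := continuous_iff_continuousAt.2 fun ω ↦ (he2 ω).continuousAt
  have hH₂c : Continuous H₂ := continuous_iff_continuousAt.2 fun ω ↦ (he3 ω).continuousAt
  -- integration by parts
  have hp1 : ∫ y in (-lam)..lam, H y * G₂ y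
      = H lam * G₁ lam - H (-lam) * G₁ (-lam) - ∫ y in (-lam)..lam, H₁ y * G₁ y :=
    intervalIntegral.integral_mul_deriv_eq_deriv_mul (fun y _ ↦ he1 y) (fun y _ ↦ hd2 y)
      (hH₁c.intervalIntegrable _ _) (hG₂c.intervalIntegrable _ _)
  have hp2 : ∫ y in (-lam)..lam, G y * H₂ y
      = G lam * H₁ lam - G (-lam) * H₁ (-lam) - ∫ y in (-lam)..lam, G₁ y * H₁ y :=
    intervalIntegral.integral_mul_deriv_eq_deriv_mul (fun y _ ↦ hd1 y) (fun y _ ↦ he2 y)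
      (hG₁c.intervalIntegrable _ _) (hH₂c.intervalIntegrable _ _)
  have hsym : ∫ y in (-lam)..lam, H₁ y * G₁ y = ∫ y in (-lam)..lam, G₁ y * H₁ y :=
    intervalIntegral.integral_congr fun y _ ↦ mul_comm _ _
  -- parity at `±λ` and the end-point relations
  have hGn : G (-lam) = G lam := prolate_cosInt_neg he lam
  have hHn : H (-lam) = H lam := prolate_cosInt_neg he' lam
  have hG₁n : G₁ (-lam) = -G₁ lam := prolate_sinInt_neg he lam
  have hH₁n : H₁ (-lam) = -H₁ lam := prolate_sinInt_neg he' lam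
  have hEe : 2 * lam * G₁ lam = (χ - (2 * π * lam * lam) ^ 2) * G lam := prolate_endpoint_relation he hχ
  have hEe' : 2 * lam * H₁ lam = (χ' - (2 * π * lam * lam) ^ 2) * H lam := prolate_endpoint_relation he' hχ'
  change lam * ((∫ y in (-lam)..lam, H y * G₂ y) - (∫ y in (-lam)..lam, G y * H₂ y)) = (χ - χ') * (G lam * H lam)
  rw [hp1, hp2, hsym, hGn, hHn, hG₁n, hH₁n]
  linear_combination (H lam) * hEe - (G lam) * hEe'

/-- Distinct even prolate functions of the same band have distinct Sturm–Liouville eigenvalues.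
[cite: Hartman2002, Ch. XI §4 Thm 4.1; SlepianPollak1961, §III] -/
theorem prolate_eigen_ne_of_ne {n n' : ℕ} (hnn' : n ≠ n') (he : IsProlateFunction lam (2 * n) e)
    (he' : IsProlateFunction lam (2 * n') e') {χ χ' : ℝ}
    (hχ : ∀ x ∈ Ioo (-lam) lam,
      -(deriv (fun y ↦ (lam ^ 2 - y ^ 2) * deriv e y) x) + (2 * π * lam * x) ^ 2 * e x = χ * e x)
    (hχ' : ∀ x ∈ Ioo (-lam) lam,
      -(deriv (fun y ↦ (lam ^ 2 - y ^ 2) * deriv e' y) x) + (2 * π * lam * x) ^ 2 * e' x = χ' * e' x) :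
    χ ≠ χ' := by
  intro hχχ
  rw [hχχ] at hχ
  have hprop := he.eq_mul_of_eigen_eq he' hχ hχ'
  have hc : e 0 / e' 0 ≠ 0 := div_ne_zero he.pos_zero.ne' he'.pos_zero.ne'
  have hZ : {x : ℝ | x ∈ Ioo (-lam) lam ∧ e x = 0} = {x : ℝ | x ∈ Ioo (-lam) lam ∧ e' x = 0} := by
    ext x
    simp only [mem_setOf_eq, hprop x, mul_eq_zero, hc, false_or]
  have h2 : 2 * n = 2 * n' := by
    rw [← he.zeros_card, ← he'.zeros_card, hZ]
  omega

/-- **THE VIRIAL IDENTITY at band `λ`**: for two prolate functions `e, e'` of band `[−λ,λ]` with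
finite-Fourier eigenvalues `μ, μ'` and Sturm–Liouville eigenvalues `χ, χ'`,
`λ(μ² − μ'²)·∫_{−λ}^{λ}(2πx)²e(x)e'(x)dx = μμ'(χ − χ')e(λ)e'(λ)`.
[cite: HoganLakey2012, Thm. 2.6.1–2.6.2, Cor. 2.6.9; SlepianPollak1961, §III] -/
theorem prolate_virial (he : IsProlateFunction lam m e) (he' : IsProlateFunction lam m' e') {χ χ' : ℝ}
    (hχ : ∀ x ∈ Ioo (-lam) lam,
      -(deriv (fun y ↦ (lam ^ 2 - y ^ 2) * deriv e y) x) + (2 * π * lam * x) ^ 2 * e x = χ * e x)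
    (hχ' : ∀ x ∈ Ioo (-lam) lam,
      -(deriv (fun y ↦ (lam ^ 2 - y ^ 2) * deriv e' y) x) + (2 * π * lam * x) ^ 2 * e' x = χ' * e' x) :
    lam * ((((∫ x in (-lam)..lam, e x) / e 0)) ^ 2 - (((∫ x in (-lam)..lam, e' x) / e' 0)) ^ 2) *
        (∫ x in (-lam)..lam, (2 * π * x) ^ 2 * (e x * e' x))
      = ((∫ x in (-lam)..lam, e x) / e 0) * ((∫ x in (-lam)..lam, e' x) / e' 0) * (χ - χ') *
          (e lam * e' lam) := by
  have hlam := he.lam_pos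
  have hle : -lam ≤ lam := by linarith
  have hmem : lam ∈ Icc (-lam) lam := ⟨by linarith, le_rfl⟩
  set μ : ℝ := (∫ x in (-lam)..lam, e x) / e 0 with hμ
  set μ' : ℝ := (∫ x in (-lam)..lam, e' x) / e' 0 with hμ'
  have hgreen := prolate_green_cosInt he he' hχ hχ'
  -- `∫ G[e'] G₂[e] = μ' ∫ e' G₂[e] = -μ'² S`, and symmetrically
  have h1 : (∫ y in (-lam)..lam, (∫ x in (-lam)..lam, e' x * Real.cos (2 * π * x * y)) *
        (∫ x in (-lam)..lam, (e x * (-(2 * π * x))) * ((2 * π * x) * Real.cos (2 * π * x * y))))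
      = μ' * (-μ * 0 + -(μ') * ∫ x in (-lam)..lam, (2 * π * x) ^ 2 * (e x * e' x)) := by
    rw [mul_zero, zero_add, ← prolate_integral_mul_cosInt₂ he he', ← intervalIntegral.integral_const_mul]
    refine intervalIntegral.integral_congr fun y hy ↦ ?_
    rw [uIcc_of_le hle] at hy
    rw [he'.integral_mul_cos_eq_mul hy, mul_assoc]
  have h2 : (∫ y in (-lam)..lam, (∫ x in (-lam)..lam, e x * Real.cos (2 * π * x * y)) *
        (∫ x in (-lam)..lam, (e' x * (-(2 * π * x))) * ((2 * π * x) * Real.cos (2 * π * x * y))))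
      = μ * (-(μ) * ∫ x in (-lam)..lam, (2 * π * x) ^ 2 * (e x * e' x)) := by
    have hS : (∫ x in (-lam)..lam, (2 * π * x) ^ 2 * (e' x * e x))
        = ∫ x in (-lam)..lam, (2 * π * x) ^ 2 * (e x * e' x) :=
      intervalIntegral.integral_congr fun x _ ↦ by rw [mul_comm (e' x)]
    rw [← hS, ← prolate_integral_mul_cosInt₂ he' he, ← intervalIntegral.integral_const_mul]
    refine intervalIntegral.integral_congr fun y hy ↦ ?_
    rw [uIcc_of_le hle] at hy
    rw [he.integral_mul_cos_eq_mul hy, mul_assoc]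
  rw [h1, h2, he.integral_mul_cos_eq_mul hmem, he'.integral_mul_cos_eq_mul hmem] at hgreen
  linear_combination hgreen

/-- **(h_I) at every band `λ`: `n ↦ |μ_{2n}(λ)|` is injective** — `|μ_{2n}| = |μ_{2n'}|` with
`n ≠ n'` kills the left side of the virial identity, while every factor of its right side is non-zero
(`prolate_mu_ne_zero`, `prolate_eigen_ne_of_ne`, `prolate_apply_band_ne_zero`).
[cite: SlepianPollak1961, §III; HoganLakey2012, Cor. 2.6.9] -/
theorem prolate_abs_mu_injective {n n' : ℕ} (he : IsProlateFunction lam (2 * n) e)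
    (he' : IsProlateFunction lam (2 * n') e')
    (h : |(∫ x in (-lam)..lam, e x) / e 0| = |(∫ x in (-lam)..lam, e' x) / e' 0|) : n = n' := by
  by_contra hnn'
  obtain ⟨χ, hχ⟩ := he.eigen
  obtain ⟨χ', hχ'⟩ := he'.eigen
  have hlam := he.lam_pos
  have hV := prolate_virial he he' hχ hχ'
  have hsq : ((∫ x in (-lam)..lam, e x) / e 0) ^ 2 - ((∫ x in (-lam)..lam, e' x) / e' 0) ^ 2 = 0 := by
    rw [← sq_abs ((∫ x in (-lam)..lam, e x) / e 0), ← sq_abs ((∫ x in (-lam)..lam, e' x) / e' 0), h,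
      sub_self]
  rw [hsq, mul_zero, zero_mul] at hV
  have hne : ((∫ x in (-lam)..lam, e x) / e 0) * ((∫ x in (-lam)..lam, e' x) / e' 0) * (χ - χ') *
      (e lam * e' lam) ≠ 0 :=
    mul_ne_zero (mul_ne_zero (mul_ne_zero (prolate_mu_ne_zero he) (prolate_mu_ne_zero he'))
      (sub_ne_zero.2 (prolate_eigen_ne_of_ne hnn' he he' hχ hχ')))
      (mul_ne_zero (prolate_apply_band_ne_zero he) (prolate_apply_band_ne_zero he'))
  exact hne hV.symm

end Virial

/-! ## M. The door with completeness as its ONLY input -/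

/-- (h_I) holds at every band. [cite: SlepianPollak1961, §III] -/
theorem injective_band (lam : ℝ) (_hlam : 0 < lam) :
    ∀ (n n' : ℕ) (e e' : ℝ → ℝ), IsProlateFunction lam (2 * n) e → IsProlateFunction lam (2 * n') e' →
      |(∫ x in (-lam)..lam, e x) / e 0| = |(∫ x in (-lam)..lam, e' x) / e' 0| → n = n' :=
  fun _ _ _ _ he he' h ↦ prolate_abs_mu_injective he he' h

/-- **The door, final form**: `Burnol2002CRAS_lem3` follows from ONE input — the completeness of the even
prolate classes of band `[−λ,λ]` in `P_λ(L²(ℝ))^{pair}` at every `λ > 0` (Slepian–Pollak 1961 §III;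
in the tree at `λ = 1`: `ConnesConsani2021.CC2021_sec4_xi_complete_holds`); the spectral simplicity
input (h_I) is now a theorem at every band (`injective_band`). [cite: Burnol2002CRAS, Lemme 3 (TeX l.289–293); SlepianPollak1961, §III] -/
theorem Burnol2002CRAS_lem3_of_complete
    (hC : ∀ lam : ℝ, 0 < lam → ∀ u ∈ evenL2, cutoffProj lam u ∈
      closure (Submodule.span ℂ {E : Lp ℂ 2 (volume : Measure ℝ) | ∃ (n : ℕ) (e : ℝ → ℝ),
        IsProlateFunction lam (2 * n) e ∧ ∀ᵐ x : ℝ, E x = (e x : ℂ)} : Set (Lp ℂ 2 (volume : Measure ℝ)))) :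
    Burnol2002CRAS_lem3 :=
  Burnol2002CRAS_lem3_of_complete_of_injective hC injective_band

end Burnol2002

end Literature.Analysis.DeBrangesSpaces
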